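import Literature.NumberTheory.Sieve.IwaniecAlmostPrimes
import Literature.NumberTheory.Sieve.IwaniecBilinearSieveBuchstab
import HarnessLib

/-!
# Iwaniec's bilinear linear sieve, X: the discharge of `lemma2_bilinearSieve`

Topic `Literature/NumberTheory/Sieve`.  This file assembles the support files
`IwaniecBilinearSieve{MainTerms,Composite,Boxes,Bilinear,Strips,Levels,Assembly,Regime,Buchstab}.lean` into
`theorem lemma2_bilinearSieve_holds : lemma2_bilinearSieve`, H. Iwaniec's Theorem 1 of *A new form of the
error term in the linear sieve*, Acta Arith. 37 (1980), 307–320 [IwaniecActaArith1980b], as vendored in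
`IwaniecAlmostPrimes.lean` (= Lemma 2 of [IwaniecInventiones1978]).

Contents: the identification of `IsLinearSieveFunctions F f` with the tree's `upperSieveFun 1`,
`lowerSieveFun 1` (method of steps); the logarithmic Lipschitz bounds `|F(a) − F(b)|, f(b) − f(a) ≪ log(b/a)`
passing from the internal level `D₄ = (MN)^{1/(1+ε+η)}` to `MN`; the density `g(d) = ω(d)/d`; the choice
of the parameters; the three regimes (trivial families for small `log MN`, the main and crude regimes per
`K`); the Buchstab layer for `D_{j*} < z ≤ (MN)^{1/2}`; the symmetry `M ↔ N`.  Everything is PROVED.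

## References

* H. Iwaniec, *A new form of the error term in the linear sieve*, Acta Arith. 37 (1980), 307–320.
  [IwaniecActaArith1980b]
* H. Iwaniec, *Almost-primes represented by quadratic polynomials*, Invent. Math. 47 (1978), 171–188,
  Lemma 2. [IwaniecInventiones1978]
-/

open Finset Real Filter Topology
open scoped ArithmeticFunction.Moebius

noncomputable section

namespace Literature.NumberTheory.Sieve

namespace Iwaniec1978

open Iwaniec1980b

/-! ### The linear-sieve functions of Lemma 2 are the tree's `F₁, f₁` -/

/-- The tree's `(F₁, f₁)` satisfy Iwaniec's characterisation. [folklore] -/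
theorem isLinearSieveFunctions_std : IsLinearSieveFunctions (upperSieveFun 1) (lowerSieveFun 1) := by
  have h := isBetaSieveSolution_upperSieveFun_one
  rw [show siftingLimit 1 = 2 from siftingLimit_one_holds, betaSieveConst_one_eq_two_mul_exp] at h
  exact IsLinearSieveFunctions.of_isBetaSieveSolution h

/-- **Uniqueness** (method of steps): any pair `(F, f)` satisfying Iwaniec's characterisation agrees with
`(F₁, f₁)` on `(0, ∞)`. [cite: IwaniecInventiones1978, Lemma 2 ("continuous solutions of the system")] -/
theorem IsLinearSieveFunctions.eq_std {F f : ℝ → ℝ} (h : IsLinearSieveFunctions F f) {s : ℝ} (hs : 0 < s) :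
    F s = upperSieveFun 1 s ∧ f s = lowerSieveFun 1 s := by
  have h₁ := isLinearSieveFunctions_std
  set U : ℝ → ℝ := fun s => F s - upperSieveFun 1 s with hU
  set u : ℝ → ℝ := fun s => f s - lowerSieveFun 1 s with hu
  have hU0 : ∀ s ∈ Set.Ioc (0:ℝ) 3, U s = 0 := by
    intro s hs
    have e1 := h.upper_eq s hs.1 hs.2
    have e2 := h₁.upper_eq s hs.1 hs.2
    have : s * U s = 0 := by rw [hU]; dsimp only; rw [mul_sub, e1, e2, sub_self]
    rcases mul_eq_zero.mp this with h0 | h0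
    · exact absurd h0 hs.1.ne'
    · exact h0
  have hu0 : ∀ s ∈ Set.Ioc (0:ℝ) 2, u s = 0 := by
    intro s hs
    rw [hu]; dsimp only
    rw [h.lower_eq_zero hs.1 hs.2, h₁.lower_eq_zero hs.1 hs.2, sub_self]
  have hUcont : ContinuousOn U (Set.Ioi 0) := h.continuousOn_upper.sub h₁.continuousOn_upper
  have hucont : ContinuousOn u (Set.Ioi 0) := h.continuousOn_lower.sub h₁.continuousOn_lower
  have hUderiv : ∀ s : ℝ, 3 < s → HasDerivAt (fun t : ℝ => t ^ (1:ℝ) * U t) (1 * s ^ ((1:ℝ) - 1) * u (s - 1)) s := by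
    intro s hs3
    have e := (h.hasDerivAt_upper s hs3).sub (h₁.hasDerivAt_upper s hs3)
    simp only [Real.rpow_one, sub_self, Real.rpow_zero, one_mul, mul_one]
    refine e.congr_of_eventuallyEq ?_
    filter_upwards with t
    simp only [hU, Pi.sub_apply]; ring
  have huderiv : ∀ s : ℝ, 2 < s → HasDerivAt (fun t : ℝ => t ^ (1:ℝ) * u t) (1 * s ^ ((1:ℝ) - 1) * U (s - 1)) s := by
    intro s hs2
    have e := (h.hasDerivAt_lower s hs2).sub (h₁.hasDerivAt_lower s hs2)
    simp only [Real.rpow_one, sub_self, Real.rpow_zero, one_mul, mul_one]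
    refine e.congr_of_eventuallyEq ?_
    filter_upwards with t
    simp only [hu, Pi.sub_apply]; ring
  -- method of steps
  have hstep : ∀ n : ℕ, (∀ s ∈ Set.Ioc (0:ℝ) (3 + n), U s = 0) ∧ ∀ s ∈ Set.Ioc (0:ℝ) (2 + n), u s = 0 := by
    intro n
    induction n with
    | zero => simp only [Nat.cast_zero, add_zero]; exact ⟨hU0, hu0⟩
    | succ n ih =>
      have hu' : ∀ s ∈ Set.Ioc (0:ℝ) (2 + n + 1), u s = 0 :=
        IsBetaSieveSolution.eqOn_zero_step (κ := 1) (by linarith) hucont ih.2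
          (fun s hs => ih.1 s ⟨hs.1, by linarith [hs.2]⟩) (fun s hs => huderiv s (by linarith))
      have hU' : ∀ s ∈ Set.Ioc (0:ℝ) (3 + n + 1), U s = 0 :=
        IsBetaSieveSolution.eqOn_zero_step (κ := 1) (by linarith) hUcont ih.1
          (fun s hs => hu' s ⟨hs.1, by linarith [hs.2]⟩) (fun s hs => hUderiv s (by linarith))
      push_cast
      exact ⟨fun s hs => hU' s ⟨hs.1, by linarith [hs.2]⟩, fun s hs => hu' s ⟨hs.1, by linarith [hs.2]⟩⟩
  obtain ⟨n, hn⟩ := exists_nat_gt s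
  have h1 := (hstep n).1 s ⟨hs, by linarith⟩
  have h2 := (hstep n).2 s ⟨hs, by linarith⟩
  rw [hU] at h1; rw [hu] at h2
  dsimp only at h1 h2
  exact ⟨by linarith, by linarith⟩

/-! ### Logarithmic Lipschitz bounds for `F₁, f₁` -/

/-- `f₁` is differentiable on `(2, ∞)` with `f₁'(t) = (F₁(t − 1) − f₁(t))/t`. [folklore] -/
theorem hasDerivAt_lowerSieveFun_one {t : ℝ} (ht : 2 < t) :
    HasDerivAt (lowerSieveFun 1) ((upperSieveFun 1 (t - 1) - lowerSieveFun 1 t) / t) t := by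
  have h := isLinearSieveFunctions_std
  have ht0 : 0 < t := by linarith
  have h1 := (h.hasDerivAt_lower t ht).div (hasDerivAt_id t) ht0.ne'
  have hev : ((fun y : ℝ => y * lowerSieveFun 1 y) / id) =ᶠ[𝓝 t] lowerSieveFun 1 := by
    filter_upwards [Ioi_mem_nhds ht0] with y hy
    have hy0 : y ≠ 0 := ne_of_gt hy
    simp only [Pi.div_apply, id]
    field_simp
  refine (h1.congr_of_eventuallyEq hev.symm).congr_deriv ?_
  simp only [id, mul_one]
  field_simp

/-- **Logarithmic Lipschitz bound for `F₁`**: `|F₁(b) − F₁(a)| ≤ (5 + 2C_d) log(b/a)` for `1 ≤ a ≤ b`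
(`x |F₁'(x)| ≤ |f₁(x−1)| + F₁(x) ≤ 5 + 2 C_d`). [folklore] -/
theorem abs_upperSieveFun_sub_le {Cd : ℝ} (hCd : 0 ≤ Cd)
    (hCdF : ∀ s : ℝ, 1 ≤ s → |upperSieveFun 1 s - 1| ≤ Cd * Real.exp (-s))
    (hCdf : ∀ s : ℝ, 2 ≤ s → |lowerSieveFun 1 s - 1| ≤ Cd * Real.exp (-s)) {a b : ℝ} (ha : 1 ≤ a) (hab : a ≤ b) :
    |upperSieveFun 1 b - upperSieveFun 1 a| ≤ (5 + 2 * Cd) * Real.log (b / a) := by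
  have h := isLinearSieveFunctions_std
  have ha0 : 0 < a := by linarith
  -- `φ(u) = F₁(e^u)` on `[log a, log b]`
  set φ : ℝ → ℝ := fun u => upperSieveFun 1 (Real.exp u) with hφ
  have hderiv : ∀ u ∈ Set.Icc (Real.log a) (Real.log b),
      HasDerivWithinAt φ (Real.exp u * ((IsLinearSieveFunctions.mulUpperDeriv (lowerSieveFun 1) (Real.exp u) - upperSieveFun 1 (Real.exp u)) /
        Real.exp u)) (Set.Icc (Real.log a) (Real.log b)) u := by
    intro u _
    have h1 := h.hasDerivAt_upper' (Real.exp_pos u)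
    have h2 := (h1.comp u (Real.hasDerivAt_exp u))
    rw [mul_comm] at h2
    exact h2.hasDerivWithinAt
  have hbound : ∀ u ∈ Set.Ico (Real.log a) (Real.log b),
      ‖Real.exp u * ((IsLinearSieveFunctions.mulUpperDeriv (lowerSieveFun 1) (Real.exp u) - upperSieveFun 1 (Real.exp u)) / Real.exp u)‖ ≤
        5 + 2 * Cd := by
    intro u hu
    have hx1 : 1 ≤ Real.exp u := by
      calc (1:ℝ) ≤ a := ha
        _ = Real.exp (Real.log a) := (Real.exp_log ha0).symm
        _ ≤ Real.exp u := Real.exp_le_exp.mpr hu.1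
    set x := Real.exp u with hx
    have hx0 : 0 < x := Real.exp_pos u
    rw [mul_div_cancel₀ _ hx0.ne', Real.norm_eq_abs]
    obtain ⟨hF1, hF4⟩ := upperSieveFun_bounds hCd hCdF hx1
    have hF : |upperSieveFun 1 x| ≤ 4 + Cd := by rw [abs_of_nonneg (by linarith)]; exact hF4
    have hM : |IsLinearSieveFunctions.mulUpperDeriv (lowerSieveFun 1) x| ≤ 1 + Cd := by
      unfold IsLinearSieveFunctions.mulUpperDeriv
      split_ifs with h3
      · simp; linarith
      · exact (lowerSieveFun_bounds hCd hCdf (s := x - 1) (by linarith)).2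
    calc |IsLinearSieveFunctions.mulUpperDeriv (lowerSieveFun 1) x - upperSieveFun 1 x| ≤
        |IsLinearSieveFunctions.mulUpperDeriv (lowerSieveFun 1) x| + |upperSieveFun 1 x| := abs_sub _ _
      _ ≤ 5 + 2 * Cd := by linarith
  have hlog : Real.log a ≤ Real.log b := Real.log_le_log ha0 hab
  have := norm_image_sub_le_of_norm_deriv_le_segment' hderiv hbound (Real.log b) ⟨hlog, le_rfl⟩
  rw [hφ] at this
  dsimp only at this
  rw [Real.exp_log ha0, Real.exp_log (by linarith), Real.norm_eq_abs, ← Real.log_div (by linarith) ha0.ne'] at this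
  exact this

/-- **Logarithmic Lipschitz bound for `f₁`**: `f₁(b) − f₁(a) ≤ (5 + 2C_d) log(b/a)` for `2 < a ≤ b`. [folklore] -/
theorem lowerSieveFun_sub_le {Cd : ℝ} (hCd : 0 ≤ Cd)
    (hCdF : ∀ s : ℝ, 1 ≤ s → |upperSieveFun 1 s - 1| ≤ Cd * Real.exp (-s))
    (hCdf : ∀ s : ℝ, 2 ≤ s → |lowerSieveFun 1 s - 1| ≤ Cd * Real.exp (-s)) {a b : ℝ} (ha : 2 < a) (hab : a ≤ b) :
    lowerSieveFun 1 b - lowerSieveFun 1 a ≤ (5 + 2 * Cd) * Real.log (b / a) := by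
  have ha0 : 0 < a := by linarith
  set φ : ℝ → ℝ := fun u => lowerSieveFun 1 (Real.exp u) with hφ
  have hderiv : ∀ u ∈ Set.Icc (Real.log a) (Real.log b),
      HasDerivWithinAt φ (Real.exp u * ((upperSieveFun 1 (Real.exp u - 1) - lowerSieveFun 1 (Real.exp u)) /
        Real.exp u)) (Set.Icc (Real.log a) (Real.log b)) u := by
    intro u hu
    have hx2 : 2 < Real.exp u := by
      calc (2:ℝ) < a := ha
        _ = Real.exp (Real.log a) := (Real.exp_log ha0).symm
        _ ≤ Real.exp u := Real.exp_le_exp.mpr hu.1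
    have h1 := hasDerivAt_lowerSieveFun_one hx2
    have h2 := (h1.comp u (Real.hasDerivAt_exp u))
    rw [mul_comm] at h2
    exact h2.hasDerivWithinAt
  have hbound : ∀ u ∈ Set.Ico (Real.log a) (Real.log b),
      ‖Real.exp u * ((upperSieveFun 1 (Real.exp u - 1) - lowerSieveFun 1 (Real.exp u)) / Real.exp u)‖ ≤
        5 + 2 * Cd := by
    intro u hu
    have hx2 : 2 < Real.exp u := by
      calc (2:ℝ) < a := ha
        _ = Real.exp (Real.log a) := (Real.exp_log ha0).symm
        _ ≤ Real.exp u := Real.exp_le_exp.mpr hu.1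
    set x := Real.exp u with hx
    have hx0 : 0 < x := Real.exp_pos u
    rw [mul_div_cancel₀ _ hx0.ne', Real.norm_eq_abs]
    obtain ⟨hF1, hF4⟩ := upperSieveFun_bounds hCd hCdF (s := x - 1) (by linarith)
    have hf := (lowerSieveFun_bounds hCd hCdf (s := x) hx2.le).2
    calc |upperSieveFun 1 (x - 1) - lowerSieveFun 1 x| ≤ |upperSieveFun 1 (x - 1)| + |lowerSieveFun 1 x| :=
          abs_sub _ _
      _ ≤ 5 + 2 * Cd := by rw [abs_of_nonneg (by linarith)]; linarith
  have hlog : Real.log a ≤ Real.log b := Real.log_le_log ha0 hab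
  have := norm_image_sub_le_of_norm_deriv_le_segment' hderiv hbound (Real.log b) ⟨hlog, le_rfl⟩
  rw [hφ] at this
  dsimp only at this
  rw [Real.exp_log ha0, Real.exp_log (by linarith), Real.norm_eq_abs, ← Real.log_div (by linarith) ha0.ne'] at this
  exact (le_abs_self _).trans this

/-- `f₁(s) ≤ 2 (s − 2)` for `2 ≤ s ≤ 4` (`f₁(s) = 2e^γ log(s − 1)/s`, `log(s − 1) ≤ s − 2`, `2e^γ ≤ 4`). [folklore] -/
theorem lowerSieveFun_le_two_mul {s : ℝ} (hs2 : 2 ≤ s) (hs4 : s ≤ 4) : lowerSieveFun 1 s ≤ 2 * (s - 2) := by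
  rw [lowerSieveFun_one_eq_holds ⟨hs2, hs4⟩]
  have hγ := two_exp_gamma_le_four
  have hlog : Real.log (s - 1) ≤ s - 2 := by
    have := Real.log_le_sub_one_of_pos (show 0 < s - 1 by linarith); linarith
  have hlog0 : 0 ≤ Real.log (s - 1) := Real.log_nonneg (by linarith)
  rw [div_le_iff₀ (by linarith)]
  have he : 0 ≤ Real.exp Real.eulerMascheroniConstant := (Real.exp_pos _).le
  nlinarith [mul_le_mul hγ hlog hlog0 (by norm_num : (0:ℝ) ≤ 4)]

/-- `0 ≤ f₁(s)` for `2 ≤ s`. [folklore] -/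
theorem lowerSieveFun_one_nonneg {s : ℝ} (hs2 : 2 ≤ s) : 0 ≤ lowerSieveFun 1 s := by
  have hsol := isBetaSieveSolution_upperSieveFun_one
  rw [show siftingLimit 1 = 2 from siftingLimit_one_holds] at hsol
  rcases le_or_gt s 4 with hs4 | hs4
  · exact hsol.lower_nonneg_of_mem_Icc one_pos ⟨hs2, by linarith⟩
  · -- `f₁` is non-decreasing on `(2, ∞)` (derivative `(F₁(t−1) − f₁(t))/t ≥ 0`)
    have h4 : 0 ≤ lowerSieveFun 1 4 := hsol.lower_nonneg_of_mem_Icc one_pos ⟨by norm_num, by norm_num⟩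
    have hmono : MonotoneOn (lowerSieveFun 1) (Set.Icc 4 s) := by
      refine monotoneOn_of_deriv_nonneg (convex_Icc 4 s) ?_ ?_ ?_
      · exact fun t ht => (hasDerivAt_lowerSieveFun_one (by linarith [ht.1])).continuousAt.continuousWithinAt
      · intro t ht
        rw [interior_Icc] at ht
        exact (hasDerivAt_lowerSieveFun_one (by linarith [ht.1])).differentiableAt.differentiableWithinAt
      · intro t ht
        rw [interior_Icc] at ht
        have ht2 : 2 < t := by linarith [ht.1]
        rw [(hasDerivAt_lowerSieveFun_one ht2).deriv]
        refine div_nonneg ?_ (by linarith)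
        have hF := BetaSieve.Iwaniec1980_lemma18_holds.one_le_upper (by norm_num : (1:ℝ) / 2 ≤ 1)
          JurkatRichert.isGreatestBetaSieveData_linear (s := t - 1) (by linarith)
        have hf := BetaSieve.Iwaniec1980_lemma18_holds.lower_le_one (by norm_num : (1:ℝ) / 2 ≤ 1)
          JurkatRichert.isGreatestBetaSieveData_linear (s := t)
            (by show siftingLimit 1 ≤ t; rw [siftingLimit_one_holds]; linarith)
        simp only at hF hf
        linarith
    exact h4.trans (hmono ⟨le_rfl, hs4.le⟩ ⟨hs4.le, le_rfl⟩ hs4.le)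

/-! ### The density `g = ω/id` -/

/-- The density `g(d) = ω(d)/d` as an arithmetic function. [cite: IwaniecInventiones1978, §3 p. 174] -/
def densityOf (ω : ArithmeticFunction ℝ) : ArithmeticFunction ℝ :=
  ⟨fun n => ω n / n, by simp⟩

/-- `g(d) = ω(d)/d`. [folklore] -/
@[simp] theorem densityOf_apply (ω : ArithmeticFunction ℝ) (n : ℕ) : densityOf ω n = ω n / n := rfl

/-- `g` is multiplicative when `ω` is. [folklore] -/
theorem isMultiplicative_densityOf {ω : ArithmeticFunction ℝ} (hω : ω.IsMultiplicative) :
    (densityOf ω).IsMultiplicative := by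
  refine ⟨by simp [densityOf_apply, hω.map_one], fun {m n} hmn => ?_⟩
  simp only [densityOf_apply, hω.map_mul_of_coprime hmn, Nat.cast_mul]
  have hm : (m : ℝ) ≠ 0 ∨ True := Or.inr trivial
  by_cases hm0 : m = 0
  · subst hm0; simp
  by_cases hn0 : n = 0
  · subst hn0; simp
  field_simp

/-- `0 ≤ g(p) < 1` at the primes. [folklore] -/
theorem densityOf_prime_bounds {ω : ArithmeticFunction ℝ} (hω0 : ∀ n, 0 ≤ ω n)
    (hωp : ∀ p : ℕ, p.Prime → ω p < p) (p : ℕ) (hp : p.Prime) : 0 ≤ densityOf ω p ∧ densityOf ω p < 1 := by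
  have hp0 : (0 : ℝ) < p := by exact_mod_cast hp.pos
  rw [densityOf_apply]
  exact ⟨div_nonneg (hω0 p) hp0.le, (div_lt_one hp0).mpr (hωp p hp)⟩

/-- `V(z) = ∏_{p < z} (1 − ω(p)/p)` is the tree's `vprod g (P(z))`. [folklore] -/
theorem vprod_densityOf_eq (ω : ArithmeticFunction ℝ) (z : ℝ) :
    BetaSieve.vprod (densityOf ω) (primesProdBelow z) = ∏ p ∈ Nat.primesBelow ⌈z⌉₊, (1 - ω p / p) := by
  rw [BetaSieve.vprod, primeFactors_primesProdBelow]; rfl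

/-- `∑_d Λ(d) |ℬ_d| = X ∑_d Λ(d) g(d) + ∑_d Λ(d) r(d)` with `r(d) = |ℬ_d| − g(d) X`. [folklore] -/
theorem sum_mul_mcount_eq (Λ : ℕ → ℝ) (B : Multiset ℤ) (X : ℝ) (ω : ArithmeticFunction ℝ) (S : Finset ℕ) :
    ∑ d ∈ S, Λ d * (mcount B d : ℝ) =
      X * ∑ d ∈ S, Λ d * densityOf ω d + ∑ d ∈ S, Λ d * ((mcount B d : ℝ) - ω d / d * X) := by
  rw [Finset.mul_sum, ← Finset.sum_add_distrib]
  refine Finset.sum_congr rfl fun d _ => ?_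
  rw [densityOf_apply]; ring

/-! ### Both regimes at once -/

/-- **The main-term bounds for all `K ≥ 1`**: the main regime and the crude regime are exhaustive, so for
`2 ≤ z ≤ D` (and `z² ≤ D` for the lower bound)
`∑ Λ⁺_z g ≤ V(z)(F₁(log D/log z) + C₁ err)`, `∑ Λ⁻_z g ≥ V(z)(f₁(log D/log z) − C₁ err)`,
`C₁ = 5·10²⁴(1 + C_d)²`, `err = ε + ε⁻⁸ eᴷ/log D`. [cite: IwaniecActaArith1980b, Lemma 2 and §5 p. 320] -/
theorem regime_bounds_all {D ε : ℝ} (hD : 1 < D) (hε : 0 < ε) (hε3 : ε ≤ 1 / 3) {g : ArithmeticFunction ℝ}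
    (hg : g.IsMultiplicative) {K : ℝ} (hK1 : 1 ≤ K)
    (h1 : ∀ w z : ℝ, 2 ≤ w → w < z →
      ∏ p ∈ (Nat.primesBelow ⌈z⌉₊).filter (fun p : ℕ => w ≤ (p : ℝ)), (1 - g p)⁻¹ ≤
        Real.log z / Real.log w * (1 + K / Real.log w))
    (h01 : ∀ p : ℕ, p.Prime → 0 ≤ g p ∧ g p < 1) {Cd : ℝ} (hCd : 0 ≤ Cd)
    (hCdF : ∀ s : ℝ, 1 ≤ s → |upperSieveFun 1 s - 1| ≤ Cd * Real.exp (-s))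
    (hCdf : ∀ s : ℝ, 2 ≤ s → |lowerSieveFun 1 s - 1| ≤ Cd * Real.exp (-s)) {z : ℝ} (hz : 2 ≤ z) (hzD : z ≤ D) :
    (∑ d ∈ (primesProdBelow z).divisors, Core.LamZ hD hε 1 z d * g d ≤
        BetaSieve.vprod g (primesProdBelow z) *
          (upperSieveFun 1 (Real.log D / Real.log z) +
            5e24 * (1 + Cd) ^ 2 * (ε + ε⁻¹ ^ 8 * Real.exp K / Real.log D))) ∧
    (z ^ 2 ≤ D →
      BetaSieve.vprod g (primesProdBelow z) *
          (lowerSieveFun 1 (Real.log D / Real.log z) -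
            5e24 * (1 + Cd) ^ 2 * (ε + ε⁻¹ ^ 8 * Real.exp K / Real.log D)) ≤
        ∑ d ∈ (primesProdBelow z).divisors, Core.LamZ hD hε 0 z d * g d) := by
  by_cases hcase : Real.log D < 200 * K * ε⁻¹ ^ 2 ∨ Real.log D < 4e4 * K ^ 2 ∨ Real.log D < 900 * ε⁻¹ ^ 2 ∨
      (Real.log D ≤ ε⁻¹ ^ 4 ∧ 1 / 30 < ε)
  · have h := Core.crude_regime_bounds hD hε hg hK1 h1 h01 hε3 hcase hz hzD
    have hV : 0 < BetaSieve.vprod g (primesProdBelow z) :=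
      vprod_pos_of_lt_one fun p hp => (h01 p (Nat.prime_of_mem_primeFactors hp)).2
    have herr : 0 ≤ ε + ε⁻¹ ^ 8 * Real.exp K / Real.log D := by
      have := Real.log_pos hD; positivity
    have hC : (5e24 : ℝ) * (ε + ε⁻¹ ^ 8 * Real.exp K / Real.log D) ≤
        5e24 * (1 + Cd) ^ 2 * (ε + ε⁻¹ ^ 8 * Real.exp K / Real.log D) := by
      have : (1:ℝ) ≤ (1 + Cd) ^ 2 := by nlinarith
      nlinarith
    refine ⟨h.1.trans (mul_le_mul_of_nonneg_left (by linarith) hV.le), fun hz2 => le_trans ?_ (h.2 hz2)⟩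
    exact mul_le_mul_of_nonneg_left (by linarith) hV.le
  · push Not at hcase
    obtain ⟨h1', h2', h3', h4'⟩ := hcase
    have ht0 : 0 < Real.log D := Real.log_pos hD
    have hKu : 200 * K ≤ ε ^ 2 * Real.log D := by
      have := mul_le_mul_of_nonneg_left h1' (by positivity : (0:ℝ) ≤ ε ^ 2)
      rw [show ε ^ 2 * (200 * K * ε⁻¹ ^ 2) = 200 * K by field_simp] at this; exact this
    have hKw : 200 * K ≤ Real.sqrt (Real.log D) := by
      have hK0 : 0 ≤ 200 * K := by linarith
      rw [show 200 * K = Real.sqrt ((200 * K) ^ 2) by rw [Real.sqrt_sq hK0]]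
      exact Real.sqrt_le_sqrt (by nlinarith)
    have h30 : 30 ≤ ε * Real.sqrt (Real.log D) := by
      have : (30 * ε⁻¹) ^ 2 ≤ Real.log D := by nlinarith
      have h := Real.sqrt_le_sqrt this
      rw [Real.sqrt_sq (by positivity)] at h
      have := mul_le_mul_of_nonneg_left h hε.le
      rw [show ε * (30 * ε⁻¹) = 30 by field_simp] at this; exact this
    have hsplit : ε⁻¹ ^ 4 < Real.log D ∨ ε ≤ 1 / 30 := by
      by_cases h : ε ≤ 1 / 30
      · exact Or.inr h
      · exact Or.inl (lt_of_not_ge fun h' => h (h4' h'))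
    exact Core.main_regime_bounds hD hε hg hK1 h1 h01 hε3 hKu hKw h30 hsplit hCd hCdF hCdf hz hzD

/-! ### The parameters -/

/-- `τ = 1 + ε + η`. [cite: IwaniecActaArith1980b, §4 p. 314] -/
def tauP (ε : ℝ) : ℝ := 1 + ε + Core.eta ε

/-- The internal level `D₄ = (MN)^{1/τ}`. [cite: IwaniecActaArith1980b, §6 p. 320 (D₄)] -/
def levD (ε M N : ℝ) : ℝ := (M * N) ^ (1 / tauP ε)

/-- `N' = N^{1/(1+η)}`. [folklore] -/
def NbP (ε N : ℝ) : ℝ := N ^ (1 / (1 + Core.eta ε))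

/-- `M' = D₄/N'`. [folklore] -/
def MbP (ε M N : ℝ) : ℝ := levD ε M N / NbP ε N

section Params

variable {ε M N : ℝ} (hε : 0 < ε) (hε3 : ε ≤ 1 / 3) (hN : 1 < N) (hNM : N ≤ M)
include hε hε3 hN hNM

omit hN hNM in
/-- `0 < η ≤ ε/6561` and `1 < τ ≤ 2`, `τ − 1 ≤ 2ε`. [folklore] -/
theorem tau_bounds : 0 < Core.eta ε ∧ Core.eta ε ≤ ε / 6561 ∧ 1 < tauP ε ∧ tauP ε ≤ 2 ∧ tauP ε - 1 ≤ 2 * ε := by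
  have hη := Core.eta_pos hε
  have hη' : Core.eta ε ≤ ε / 6561 := by
    rw [Core.eta]
    have h8 : ε ^ 8 ≤ (1 / 3) ^ 8 := pow_le_pow_left₀ hε.le hε3 8
    have : ε ^ 9 = ε ^ 8 * ε := by ring
    rw [this]; nlinarith
  refine ⟨hη, hη', by rw [tauP]; linarith, by rw [tauP]; linarith, by rw [tauP]; linarith⟩

/-- `1 < D₄`, `log D₄ = log(MN)/τ`. [folklore] -/
theorem levD_basic : 1 < levD ε M N ∧ Real.log (levD ε M N) = Real.log (M * N) / tauP ε := by
  obtain ⟨-, -, hτ1, -, -⟩ := tau_bounds hε hε3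
  have hMN : 1 < M * N := by nlinarith
  refine ⟨Real.one_lt_rpow hMN (by positivity), ?_⟩
  rw [levD, Real.log_rpow (by linarith), one_div, inv_mul_eq_div]

/-- `N' ≥ 1`, `N'^{1+η} = N`, `M' N' = D₄`, `M' ≥ 1`, `D₄^ε M'^{1+η} = M`. [folklore] -/
theorem params_spec :
    1 ≤ NbP ε N ∧ NbP ε N ^ (1 + Core.eta ε) = N ∧ MbP ε M N * NbP ε N = levD ε M N ∧ 1 ≤ MbP ε M N ∧
      levD ε M N ^ ε * MbP ε M N ^ (1 + Core.eta ε) = M := by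
  obtain ⟨hη, hη', hτ1, hτ2, -⟩ := tau_bounds hε hε3
  have hN0 : (0:ℝ) ≤ N := by linarith
  have hMN1 : 1 < M * N := by nlinarith
  have hMN0 : (0:ℝ) ≤ M * N := by linarith
  have hD0 : 0 < levD ε M N := Real.rpow_pos_of_pos (by linarith) _
  have hNb : NbP ε N ^ (1 + Core.eta ε) = N := by
    rw [NbP, ← Real.rpow_mul hN0, one_div, inv_mul_cancel₀ (by linarith), Real.rpow_one]
  have hNb1 : 1 ≤ NbP ε N := Real.one_le_rpow hN.le (by positivity)
  have hNb0 : 0 < NbP ε N := by linarith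
  have hMbNb : MbP ε M N * NbP ε N = levD ε M N := div_mul_cancel₀ _ hNb0.ne'
  -- `N' ≤ D₄`
  have hNbD : NbP ε N ≤ levD ε M N := by
    rw [NbP, levD]
    have h1 : 1 / (1 + Core.eta ε) ≤ 2 / tauP ε := by
      rw [div_le_div_iff₀ (by linarith) (by linarith), tauP]; nlinarith
    calc N ^ (1 / (1 + Core.eta ε)) ≤ N ^ (2 / tauP ε) := Real.rpow_le_rpow_of_exponent_le hN.le h1
      _ = (N * N) ^ (1 / tauP ε) := by
          rw [show N * N = N ^ (2:ℝ) by rw [Real.rpow_two, sq], ← Real.rpow_mul hN0]; ring_nf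
      _ ≤ (M * N) ^ (1 / tauP ε) :=
          Real.rpow_le_rpow (by positivity) (by nlinarith) (by positivity)
  have hMb1 : 1 ≤ MbP ε M N := by rw [MbP, le_div_iff₀ hNb0, one_mul]; exact hNbD
  refine ⟨hNb1, hNb, hMbNb, hMb1, ?_⟩
  rw [MbP, Real.div_rpow hD0.le hNb0.le, hNb, mul_div_assoc', ← Real.rpow_add hD0,
    show ε + (1 + Core.eta ε) = tauP ε by rw [tauP]; ring, levD, ← Real.rpow_mul hMN0, one_div,
    inv_mul_cancel₀ (by linarith), Real.rpow_one, mul_div_assoc, div_self (by linarith), mul_one]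

/-- `(MN)^{1/2} ≤ D₄` (`τ ≤ 2`). [folklore] -/
theorem sqrt_le_levD : (M * N) ^ (1 / 2 : ℝ) ≤ levD ε M N := by
  obtain ⟨-, -, hτ1, hτ2, -⟩ := tau_bounds hε hε3
  have hMN1 : 1 ≤ M * N := by nlinarith
  rw [levD]
  exact Real.rpow_le_rpow_of_exponent_le hMN1 (by rw [div_le_div_iff₀ (by norm_num) (by linarith)]; linarith)

end Params

/-! ### Geometry of the boxes in the real branch (`log D ≥ 8100`) -/

section Geometry

variable {D ε : ℝ} (hD : 1 < D) (hε : 0 < ε) (hε3 : ε ≤ 1 / 3) (ht : 8100 ≤ Real.log D)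
include hD hε hε3 ht

omit hε hε3 in
/-- `D^{2/9} + 1 ≤ √D` for `log D ≥ 8100` (so that `u + 1, D_1 + 1 ≤ √D`). [folklore] -/
theorem rpow_add_one_le_sqrt : D ^ (2 / 9 : ℝ) + 1 ≤ Real.sqrt D := by
  have hD0 : 0 < D := by linarith
  rw [Real.sqrt_eq_rpow]
  have h1 : 1 ≤ D ^ (2 / 9 : ℝ) := Real.one_le_rpow hD.le (by norm_num)
  have h2 : (2:ℝ) ≤ D ^ (5 / 18 : ℝ) := by
    rw [← Real.exp_log hD0, ← Real.exp_one_rpow, ← Real.rpow_mul (Real.exp_pos 1).le, Real.exp_one_rpow]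
    have : Real.log 2 ≤ Real.log D * (5 / 18) := by have := Real.log_two_lt_d9; linarith
    calc (2:ℝ) = Real.exp (Real.log 2) := (Real.exp_log two_pos).symm
      _ ≤ Real.exp (Real.log D * (5 / 18)) := Real.exp_le_exp.mpr this
  have h3 : D ^ (1 / 2 : ℝ) = D ^ (2 / 9 : ℝ) * D ^ (5 / 18 : ℝ) := by
    rw [← Real.rpow_add hD0]; norm_num
  rw [h3]; nlinarith

/-- `u + 1 ≤ √D` and `D_1 + 1 ≤ √D`. [folklore] -/
theorem uu_grid_one_le :
    Core.uu D ε + 1 ≤ Real.sqrt D ∧ grid D ε (Core.eta ε) 1 + 1 ≤ Real.sqrt D := by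
  have h := rpow_add_one_le_sqrt hD ht
  obtain ⟨hη, hη', -, -, -⟩ := tau_bounds hε hε3
  have hε2 : ε ^ 2 ≤ 1 / 9 := by nlinarith
  have hu : Core.uu D ε ≤ D ^ (2 / 9 : ℝ) := by
    rw [Core.uu_def]; exact Real.rpow_le_rpow_of_exponent_le hD.le (by linarith)
  have hg : grid D ε (Core.eta ε) 1 ≤ D ^ (2 / 9 : ℝ) := by
    rw [grid, pow_one]; exact Real.rpow_le_rpow_of_exponent_le hD.le (by nlinarith)
  exact ⟨by linarith, by linarith⟩

/-- **The top box in the real branch**: with `Δ = D_{j*}`: `1 ≤ j*`, `Δ ≤ √D`, `Δ² ≤ D`,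
`(1+η) log Δ ≥ log D/2 − log 2`, `log D/4 ≤ log Δ`, `D^{1/4} ≤ Δ`, `2 ≤ Δ`. [folklore] -/
theorem topBox_spec :
    1 ≤ Core.jstar hD hε ∧ grid D ε (Core.eta ε) (Core.jstar hD hε) ≤ Real.sqrt D ∧
      grid D ε (Core.eta ε) (Core.jstar hD hε) ^ 2 ≤ D ∧
      Real.log D / 2 - Real.log 2 ≤ (1 + Core.eta ε) * Real.log (grid D ε (Core.eta ε) (Core.jstar hD hε)) ∧
      Real.log D / 4 ≤ Real.log (grid D ε (Core.eta ε) (Core.jstar hD hε)) ∧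
      D ^ (1 / 4 : ℝ) ≤ grid D ε (Core.eta ε) (Core.jstar hD hε) ∧
      2 ≤ grid D ε (Core.eta ε) (Core.jstar hD hε) := by
  have hD0 : 0 < D := by linarith
  obtain ⟨hη, hη', -, -, -⟩ := tau_bounds hε hε3
  obtain ⟨hu, hg1⟩ := uu_grid_one_le hD hε hε3 ht
  set Δ := grid D ε (Core.eta ε) (Core.jstar hD hε) with hΔ
  have hj := Core.one_le_jstar hD hε hg1
  have hΔle := Core.grid_jstar_le hD hε hu
  have hΔpos : 0 < Δ := grid_pos hD0 _
  have hsqrt0 : 0 < Real.sqrt D := Real.sqrt_pos.mpr hD0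
  have hΔ2 : Δ ^ 2 ≤ D := by
    calc Δ ^ 2 ≤ Real.sqrt D ^ 2 := pow_le_pow_left₀ hΔpos.le hΔle 2
      _ = D := Real.sq_sqrt hD0.le
  -- `Δ^{1+η} > √D − 1 ≥ √D/2`
  have hsucc := Core.lt_grid_jstar_succ hD hε
  rw [grid_succ hD0.le, ← hΔ] at hsucc
  have hsD : (2:ℝ) ≤ Real.sqrt D := by
    have := rpow_add_one_le_sqrt hD ht
    have h1 : 1 ≤ D ^ (2 / 9 : ℝ) := Real.one_le_rpow hD.le (by norm_num)
    linarith
  have hlog1 : Real.log D / 2 - Real.log 2 ≤ (1 + Core.eta ε) * Real.log Δ := by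
    have h1 : Real.sqrt D / 2 ≤ Δ ^ (1 + Core.eta ε) := by linarith
    have h2 := Real.log_le_log (by positivity) h1
    rw [Real.log_div hsqrt0.ne' two_ne_zero, Real.log_sqrt hD0.le, Real.log_rpow hΔpos] at h2
    linarith
  have hlog2 : Real.log D / 4 ≤ Real.log Δ := by
    have := Real.log_two_lt_d9
    nlinarith [Real.log_nonneg (show (1:ℝ) ≤ Δ from (one_lt_grid hD hε (by linarith) _).le)]
  have hD4 : D ^ (1 / 4 : ℝ) ≤ Δ := by
    rw [← Real.exp_log hD0, ← Real.exp_one_rpow, ← Real.rpow_mul (Real.exp_pos 1).le, Real.exp_one_rpow,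
      ← Real.exp_log hΔpos]
    exact Real.exp_le_exp.mpr (by linarith)
  have h2Δ : 2 ≤ Δ := by
    have : Real.log 2 ≤ Real.log Δ := by have := Real.log_two_lt_d9; linarith
    exact (Real.log_le_log_iff two_pos hΔpos).mp this
  exact ⟨hj, hΔle, hΔ2, hlog1, hlog2, hD4, h2Δ⟩

end Geometry

/-! ### The rows of the real branch and the evaluation of their bilinear forms -/

section Rows

variable {D ε : ℝ} (hD : 1 < D) (hε : 0 < ε) {D' : ℝ} (hD' : 1 < D')

/-- The lower `m`-rows of the real branch: the negated outer lower coefficients for `l < L₁`, then the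
Buchstab rows (case A: `[m prime ≥ Δ]`; case B: `aRowB`). [folklore] -/
def alRow (j₀ : ℕ) (Mb : ℝ) (cA' : Bool) (L₁ : ℕ) (l m : ℕ) : ℝ :=
  if l < L₁ then -Core.cA hD hε 0 j₀ Mb l m
  else if cA' then Core.aRowA (grid D ε (Core.eta ε) (j₀ + 1)) m
  else Core.aRowB hD' hε (grid D ε (Core.eta ε) (j₀ + 1)) (l - L₁) m

/-- The lower `n`-rows of the real branch. [folklore] -/
def blRow (Mb : ℝ) (cA' : Bool) (L₁ : ℕ) (l n : ℕ) : ℝ :=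
  if l < L₁ then Core.cB hD hε Mb l n
  else if cA' then Core.rowInner hD' hε (l - L₁) n else Core.bRowB n

include hD hε hD'

/-- `|alRow| ≤ 1`. [folklore] -/
theorem abs_alRow_le_one (hε3 : ε ≤ 1 / 3) (j₀ : ℕ) (Mb : ℝ) (cA' : Bool) (L₁ : ℕ)
    (hΔ : D' ≤ grid D ε (Core.eta ε) (j₀ + 1)) (l m : ℕ) :
    |alRow hD hε hD' j₀ Mb cA' L₁ l m| ≤ 1 := by
  unfold alRow
  split_ifs
  · rw [abs_neg]; exact Core.abs_cA_le_one hD hε 0 j₀ Mb l m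
  · exact Core.abs_aRowA_le_one _ m
  · exact Core.abs_aRowB_le_one hD' hε hε3 hΔ _ m

/-- `|blRow| ≤ 1`. [folklore] -/
theorem abs_blRow_le_one (Mb : ℝ) (cA' : Bool) (L₁ : ℕ) (l n : ℕ) :
    |blRow hD hε hD' Mb cA' L₁ l n| ≤ 1 := by
  unfold blRow
  split_ifs
  · exact Core.abs_cB_le_one hD hε Mb l n
  · exact Core.abs_rowInner_le_one hD' hε _ n
  · exact Core.abs_bRowB_le_one n

omit hD' in
/-- **The outer lower rows evaluate to `−∑ Λ⁻ r` at `min(z, Δ)`** (`Δ = D_{j₀+1}`): for `z ≤ Δ` this is the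
remainder identity; for `z ≥ Δ` the indicator `[mn ∣ P(z)]` may be replaced by `[mn ∣ P(Δ)]` on the support
of the rows. [cite: IwaniecActaArith1980b, Theorem 1 and p. 308] -/
theorem outer_lower_rows_eval (hε3 : ε ≤ 1 / 3) (j₀ : ℕ) (hΔ : grid D ε (Core.eta ε) (j₀ + 1) ^ 2 ≤ D)
    {Mb Nb : ℝ} (hMb : 1 ≤ Mb) (hNb : 1 ≤ Nb) (hMN : Mb * Nb = D)
    {A B : ℝ} (hA : D ^ ε * Mb ^ (1 + Core.eta ε) ≤ A) (hB : Nb ^ (1 + Core.eta ε) ≤ B) (hB1 : 1 < B)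
    {L₁ : ℕ} (hL : (Core.Univ hD hε).card ≤ L₁) {z : ℝ} (hz : z ≤ D) (r : ℕ → ℝ) :
    ∑ l ∈ Finset.range L₁, ∑ m ∈ Finset.Ico 1 ⌈A⌉₊, ∑ n ∈ Finset.Ico 1 ⌈B⌉₊,
        (if m * n ∣ primesProdBelow z then -Core.cA hD hε 0 j₀ Mb l m * Core.cB hD hε Mb l n * r (m * n) else 0) =
      -∑ d ∈ (primesProdBelow (min z (grid D ε (Core.eta ε) (j₀ + 1)))).divisors,
        Core.LamZ hD hε 0 (min z (grid D ε (Core.eta ε) (j₀ + 1))) d * r d := by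
  set Δ := grid D ε (Core.eta ε) (j₀ + 1) with hΔdef
  have hzmin : min z Δ ≤ D := (min_le_left _ _).trans hz
  rw [Core.sum_LamZ_mul_eq_bilinear hD hε hε3 0 j₀ hΔ hMb hNb hMN hA hB hB1 hL hzmin
    (fun _ => min_le_right _ _) r, ← Finset.sum_neg_distrib]
  refine Finset.sum_congr rfl fun l _ => ?_
  rw [← Finset.sum_neg_distrib]
  refine Finset.sum_congr rfl fun m _ => ?_
  rw [← Finset.sum_neg_distrib]
  refine Finset.sum_congr rfl fun n _ => ?_
  -- the indicators agree on the support of the rows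
  by_cases h0 : Core.cA hD hε 0 j₀ Mb l m * Core.cB hD hε Mb l n = 0
  · simp only [neg_mul, h0, zero_mul, neg_zero, ite_self]
  have hsupp := Core.primeFactors_lt_of_row_ne_zero hD hε j₀ Mb h0
  have hiff : m * n ∣ primesProdBelow z ↔ m * n ∣ primesProdBelow (min z Δ) := by
    rcases le_total z Δ with hzΔ | hΔz
    · rw [min_eq_left hzΔ]
    · rw [min_eq_right hΔz]
      constructor
      · intro h
        exact BetaSieve.dvd_primesProdBelow_of_primeFactors_lt
          ((squarefree_primesProdBelow z).squarefree_of_dvd h) hsupp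
      · intro h; exact h.trans (SieveSequence.primesProdBelow_dvd hΔz)
  simp only [hiff, neg_mul]
  split_ifs <;> ring

/-- **The Buchstab rows evaluate to `∑_{Δ ≤ p < z} ∑_d Λ'⁺(d) r(pd)`** (in either case A or case B).
[cite: IwaniecActaArith1980b, p. 308 ("by Buchstab's identity")] -/
theorem buchstab_rows_eval (hε3 : ε ≤ 1 / 3) (j₀ : ℕ) {Δ : ℝ} (hΔdef : Δ = grid D ε (Core.eta ε) (j₀ + 1))
    (hD'Δ : D' ≤ Δ) {z M N : ℝ} (hzM : z ≤ M) (hN : 1 < N) (cA' : Bool)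
    (hcase : (cA' = true ∧ ⌈Core.innerA D' ε⌉₊ ≤ ⌈N⌉₊) ∨ (cA' = false ∧ z * Core.innerA D' ε ≤ M))
    {L₁ : ℕ} (hL' : (Core.Univ hD' hε).card ≤ L₁) (Mb : ℝ) (r : ℕ → ℝ) :
    ∑ l ∈ Finset.range L₁, ∑ m ∈ Finset.Ico 1 ⌈M⌉₊, ∑ n ∈ Finset.Ico 1 ⌈N⌉₊,
        (if m * n ∣ primesProdBelow z then
          alRow hD hε hD' j₀ Mb cA' L₁ (L₁ + l) m * blRow hD hε hD' Mb cA' L₁ (L₁ + l) n * r (m * n) else 0) =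
      ∑ p ∈ (Nat.primesBelow ⌈z⌉₊).filter (fun p : ℕ => Δ ≤ (p : ℝ)),
        ∑ d ∈ (primesProdBelow D').divisors, Core.LamZ hD' hε 1 D' d * r (p * d) := by
  -- the rows for `l ≥ L₁`
  have hrow : ∀ l m n, alRow hD hε hD' j₀ Mb cA' L₁ (L₁ + l) m * blRow hD hε hD' Mb cA' L₁ (L₁ + l) n =
      if cA' then Core.aRowA Δ m * Core.rowInner hD' hε l n else Core.aRowB hD' hε Δ l m * Core.bRowB n := by
    intro l m n
    unfold alRow blRow
    have h : ¬ (L₁ + l < L₁) := by omega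
    rw [if_neg h, if_neg h, Nat.add_sub_cancel_left, ← hΔdef]
    split_ifs <;> rfl
  simp only [hrow]
  -- inner identity, summed over `p`
  have hinner : ∀ p : ℕ, ∑ l ∈ Finset.range L₁, Core.innerForm hD' hε l (fun d => r (p * d)) =
      ∑ d ∈ (primesProdBelow D').divisors, Core.LamZ hD' hε 1 D' d * r (p * d) := fun p =>
    Core.sum_innerForm_eq hD' hε hε3 hL' _
  have hR : ∑ p ∈ (Nat.primesBelow ⌈z⌉₊).filter (fun p : ℕ => Δ ≤ (p : ℝ)),
      ∑ d ∈ (primesProdBelow D').divisors, Core.LamZ hD' hε 1 D' d * r (p * d) =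
      ∑ p ∈ (Nat.primesBelow ⌈z⌉₊).filter (fun p : ℕ => Δ ≤ (p : ℝ)),
        ∑ l ∈ Finset.range L₁, Core.innerForm hD' hε l (fun d => r (p * d)) :=
    Finset.sum_congr rfl fun p _ => (hinner p).symm
  rw [hR]
  conv_rhs => rw [Finset.sum_comm]
  refine Finset.sum_congr rfl fun l _ => ?_
  by_cases hzD' : D' ≤ z
  · rcases hcase with ⟨hc, hAN⟩ | ⟨hc, hzA⟩
    · subst hc; simp only [if_true]
      exact Core.rows_A_eval hD' hε hε3 hD'Δ hzD' hzM hAN l r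
    · subst hc
      simp only [Bool.false_eq_true, if_false]
      exact Core.rows_B_eval hD' hε hε3 hD'Δ hzD' hzA hN l r
  · -- `z < D' ≤ Δ`: both sides vanish
    push Not at hzD'
    have hT : (Nat.primesBelow ⌈z⌉₊).filter (fun p : ℕ => Δ ≤ (p : ℝ)) = ∅ := by
      refine Finset.filter_false_of_mem fun p hp => ?_
      rw [Nat.mem_primesBelow] at hp
      have : (p : ℝ) < z := Nat.lt_ceil.mp hp.1
      push Not; linarith
    rw [hT, Finset.sum_empty]
    refine Finset.sum_eq_zero fun m _ => Finset.sum_eq_zero fun n _ => ?_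
    by_cases hmn : m * n ∣ primesProdBelow z
    swap
    · rw [if_neg hmn]
    rw [if_pos hmn]
    cases cA'
    · simp only [Bool.false_eq_true, if_false]
      have : Core.aRowB hD' hε Δ l m = 0 := by
        unfold Core.aRowB
        refine Finset.sum_eq_zero fun p hp => ?_
        exfalso
        rw [Finset.mem_filter] at hp
        have hpp := Nat.prime_of_mem_primeFactors hp.1
        have := (dvd_primesProdBelow_iff hpp z).mp ((Nat.dvd_of_mem_primeFactors hp.1).trans
          ((dvd_mul_right m n).trans hmn))
        linarith [hp.2]
      rw [this]; ring
    · simp only [if_true]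
      have : Core.aRowA Δ m = 0 := by
        unfold Core.aRowA
        rw [if_neg]
        rintro ⟨hmp, hΔm⟩
        have := (dvd_primesProdBelow_iff hmp z).mp ((dvd_mul_right m n).trans hmn)
        linarith
      rw [this]; ring

end Rows

/-! ### Pure-real lemmas for the Buchstab layer in the main regime -/

/-- **Geometry of the Buchstab layer** (pure real): with `L_Δ = log Δ`, `L_z = log z`, `t = log D₄`,
`(1+η)L_Δ ≥ t/2 − log 2`, `L_Δ ≤ t/2`, `L_Δ < L_z ≤ τt/2`: the ratios `L_z ≤ 1.335 L_Δ`,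
`L_z − L_Δ ≤ (1.001ε + 2/t) L_Δ`, `t ≤ 2.01 L_Δ`, and `2 ≤ s`, `s − 2 ≤ 2.003 ε + 3/t` for `s = τ t/L_z`.
[folklore] -/
theorem buchstab_geometry {ε η t LΔ Lz s : ℝ} (hε : 0 < ε) (hε3 : ε ≤ 1 / 3) (hη0 : 0 ≤ η)
    (hηε : η ≤ ε / 6561) (ht : 8100 ≤ t) (hLΔ : t / 2 - 0.6932 ≤ (1 + η) * LΔ) (hLΔ' : LΔ ≤ t / 2)
    (hLz : Lz ≤ (1 + ε + η) * t / 2) (hΔz : LΔ < Lz) (hs : s = (1 + ε + η) * t / Lz) :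
    0 < LΔ ∧ Lz ≤ 1.335 * LΔ ∧ Lz - LΔ ≤ (1.001 * ε + 2 / t) * LΔ ∧ t ≤ 2.01 * LΔ ∧ 2 ≤ s ∧
      s - 2 ≤ 2.003 * ε + 3 / t := by
  have hη1 : η ≤ 0.0001 := by linarith
  have hLΔ0 : 0 < LΔ := by nlinarith
  have hLz0 : 0 < Lz := by linarith
  have ht0 : 0 < t := by linarith
  have hτ : (1 + ε + η) * (1 + η) ≤ 1.3336 := by nlinarith
  have hτ' : (1 + ε + η) * (1 + η) ≤ 1 + 1.001 * ε := by nlinarith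
  have h201 : t ≤ 2.01 * LΔ := by nlinarith
  -- `(1+η) L_z ≤ τ(1+η) t/2`
  have hLz' : (1 + η) * Lz ≤ (1 + ε + η) * (1 + η) * t / 2 := by nlinarith
  have h1335 : Lz ≤ 1.335 * LΔ := by nlinarith
  have hdiff : Lz - LΔ ≤ (1.001 * ε + 2 / t) * LΔ := by
    -- `(1+η)(L_z − L_Δ) ≤ (1 + 1.001ε) t/2 − (t/2 − 0.6932) = 1.001 ε t/2 + 0.6932`
    have h1 : (1 + η) * (Lz - LΔ) ≤ 1.001 * ε * t / 2 + 0.6932 := by nlinarith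
    -- and `(1.001 ε + 2/t)(1+η) L_Δ ≥ (1.001 ε + 2/t)(t/2 − 0.6932) ≥ 1.001 ε t/2 + 0.6932` for `t ≥ 8100`
    have h2 : (1.001 * ε + 2 / t) * (t / 2 - 0.6932) ≥ 1.001 * ε * t / 2 + 0.6932 := by
      have : (1.001 * ε + 2 / t) * (t / 2 - 0.6932) = 1.001 * ε * t / 2 + 1 - 0.6938932 * ε - 1.3864 / t := by
        field_simp; ring
      rw [this]
      have : 1.3864 / t ≤ 0.001 := by rw [div_le_iff₀ ht0]; linarith
      nlinarith
    have h3 : (1.001 * ε + 2 / t) * (t / 2 - 0.6932) ≤ (1.001 * ε + 2 / t) * ((1 + η) * LΔ) :=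
      mul_le_mul_of_nonneg_left hLΔ (by positivity)
    have h5 : (1.001 * ε + 2 / t) * ((1 + η) * LΔ) = (1 + η) * ((1.001 * ε + 2 / t) * LΔ) := by ring
    have h4 : (1 + η) * (Lz - LΔ) ≤ (1 + η) * ((1.001 * ε + 2 / t) * LΔ) := by linarith
    exact le_of_mul_le_mul_left h4 (by linarith)
  have hs2 : 2 ≤ s := by
    rw [hs, le_div_iff₀ hLz0]; linarith
  have hs3 : s - 2 ≤ 2.003 * ε + 3 / t := by
    -- `s − 2 = (τ t − 2 L_z)/L_z < (τ t − 2 L_Δ)/L_Δ` and `(1+η)(τ t − 2L_Δ) ≤ 1.001 ε t + 1.3864`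
    have hs' : s - 2 = ((1 + ε + η) * t - 2 * Lz) / Lz := by rw [hs]; field_simp
    have hnum0 : 0 ≤ (1 + ε + η) * t - 2 * Lz := by linarith
    have hle : ((1 + ε + η) * t - 2 * Lz) / Lz ≤ ((1 + ε + η) * t - 2 * LΔ) / LΔ := by
      rw [div_le_div_iff₀ hLz0 hLΔ0]; nlinarith
    have hkey : ((1 + ε + η) * t - 2 * LΔ) / LΔ ≤ 2.003 * ε + 3 / t := by
      rw [div_le_iff₀ hLΔ0]
      have h1 : (1 + η) * ((1 + ε + η) * t - 2 * LΔ) ≤ 1.001 * ε * t + 1.3864 := by nlinarith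
      have h2 : (2.003 * ε + 3 / t) * (t / 2 - 0.6932) ≥ 1.001 * ε * t + 1.3864 := by
        have : (2.003 * ε + 3 / t) * (t / 2 - 0.6932) = 1.0015 * ε * t + 1.5 - 1.3884796 * ε - 2.0796 / t := by
          field_simp; ring
        rw [this]
        have : 2.0796 / t ≤ 0.001 := by rw [div_le_iff₀ ht0]; linarith
        nlinarith
      have h3 : (2.003 * ε + 3 / t) * (t / 2 - 0.6932) ≤ (2.003 * ε + 3 / t) * ((1 + η) * LΔ) :=
        mul_le_mul_of_nonneg_left hLΔ (by positivity)
      have h5 : (2.003 * ε + 3 / t) * ((1 + η) * LΔ) = (1 + η) * ((2.003 * ε + 3 / t) * LΔ) := by ring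
      have h4 : (1 + η) * ((1 + ε + η) * t - 2 * LΔ) ≤ (1 + η) * ((2.003 * ε + 3 / t) * LΔ) := by linarith
      exact le_of_mul_le_mul_left h4 (by linarith)
    rw [hs']; exact hle.trans hkey
  exact ⟨hLΔ0, h1335, hdiff, h201, hs2, hs3⟩

set_option maxHeartbeats 800000 in
/-- **The Buchstab layer in the main regime** (pure real): from `G⁻(Δ) ≥ −V(Δ) C₁ err`,
`G'⁺ ≤ V(y₁)(4 + 4 C₁ err)`, `∑_{Δ ≤ p < z} g(p) ≤ (L_z − L_Δ + K)/L_Δ`, the ratio bounds for `V(Δ)/V(z)`,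
`V(y₁)/V(z)` and `f₁(s) ≤ 2(s − 2)`, one gets `V(z)(f₁(s) − E) ≤ G⁻(Δ) − (∑ g(p)) G'⁺` as soon as
`E ≥ 6 C₁ err`. [cite: IwaniecActaArith1980b, p. 308] -/
theorem buchstab_main_real {ε t K C₁ err E LΔ Lz s V VΔ Vy G0 G' σ fs : ℝ}
    (hε : 0 < ε) (hε3 : ε ≤ 1 / 3) (ht : 8100 ≤ t) (hK1 : 1 ≤ K) (hKt : 200 * K ≤ ε ^ 2 * t)
    (hLΔ0 : 0 < LΔ) (hΔz : LΔ < Lz) (h1335 : Lz ≤ 1.335 * LΔ) (hdiff : Lz - LΔ ≤ (1.001 * ε + 2 / t) * LΔ)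
    (h201 : t ≤ 2.01 * LΔ) (hLz : Lz ≤ (1 + ε + ε / 6561) * t / 2) (hs3 : s - 2 ≤ 2.003 * ε + 3 / t)
    (hV : 0 < V) (hVΔ : VΔ ≤ V * (Lz / LΔ * (1 + K / LΔ)))
    (hVy : Vy ≤ V * (Lz / (t / 4) * (1 + K / (t / 4)))) (hVy0 : 0 ≤ Vy)
    (hσ : σ ≤ (Lz - LΔ + K) / LΔ) (hσ0 : 0 ≤ σ) (hC₁ : 5e24 ≤ C₁)
    (herr : ε + K / t ≤ err) (herr0 : 0 ≤ err)
    (hG0 : -(VΔ * (C₁ * err)) ≤ G0) (hG' : G' ≤ Vy * (4 + 4 * (C₁ * err)))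
    (hfs : fs ≤ 2 * (s - 2)) (hE : 6 * C₁ * err ≤ E) :
    V * (fs - E) ≤ G0 - σ * G' := by
  have ht0 : 0 < t := by linarith
  have hLz0 : 0 < Lz := by linarith
  have hKt' : K / t ≤ 1 / 1800 := by
    rw [div_le_iff₀ ht0]
    have : ε ^ 2 ≤ 1 / 9 := by nlinarith
    nlinarith
  have hKt0 : 0 ≤ K / t := by positivity
  have h1t : 1 / t ≤ K / t := div_le_div_of_nonneg_right hK1 ht0.le
  -- ratio bounds
  have hKL : K / LΔ ≤ 2.01 * (K / t) := by
    calc K / LΔ ≤ K / (t / 2.01) :=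
          div_le_div_of_nonneg_left (by linarith) (by positivity) (by rw [div_le_iff₀ (by norm_num)]; linarith)
      _ = 2.01 * (K / t) := by field_simp
  have hA1 : Lz / LΔ * (1 + K / LΔ) ≤ 1.34 := by
    have h1 : Lz / LΔ ≤ 1.335 := by rw [div_le_iff₀ hLΔ0]; linarith
    have h2' : K / LΔ ≤ 0.0012 := by linarith
    calc Lz / LΔ * (1 + K / LΔ) ≤ 1.335 * (1 + 0.0012) :=
          mul_le_mul h1 (by linarith) (by positivity) (by norm_num)
      _ ≤ 1.34 := by norm_num
  have hA2 : Lz / (t / 4) * (1 + K / (t / 4)) ≤ 2.68 := by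
    have h1 : Lz / (t / 4) ≤ 2 * (1 + ε + ε / 6561) := by
      rw [div_le_iff₀ (by positivity)]; linarith
    have h1' : Lz / (t / 4) ≤ 2.67 := by linarith
    have h2 : K / (t / 4) = 4 * (K / t) := by field_simp
    calc Lz / (t / 4) * (1 + K / (t / 4)) ≤ 2.67 * (1 + 4 * (1 / 1800)) := by
          rw [h2]; exact mul_le_mul h1' (by linarith) (by positivity) (by norm_num)
      _ ≤ 2.68 := by norm_num
  have hA3 : (Lz - LΔ + K) / LΔ ≤ 1.001 * ε + 2 / t + 2.01 * (K / t) := by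
    have : (Lz - LΔ + K) / LΔ = (Lz - LΔ) / LΔ + K / LΔ := by field_simp
    rw [this]
    have h1 : (Lz - LΔ) / LΔ ≤ 1.001 * ε + 2 / t := by rw [div_le_iff₀ hLΔ0]; exact hdiff
    linarith
  have h2t : 2 / t ≤ 2 * (K / t) := by
    have : 2 / t = 2 * (1 / t) := by ring
    rw [this]; linarith
  have h3t : 3 / t ≤ 3 * (K / t) := by
    have : 3 / t = 3 * (1 / t) := by ring
    rw [this]; linarith
  have hA3' : σ ≤ 1.001 * ε + 4.01 * (K / t) := by linarith
  -- the right-hand side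
  have hVΔ' : VΔ ≤ V * 1.34 := hVΔ.trans (mul_le_mul_of_nonneg_left hA1 hV.le)
  have hVy' : Vy ≤ V * 2.68 := hVy.trans (mul_le_mul_of_nonneg_left hA2 hV.le)
  have hCe0 : 0 ≤ C₁ * err := by nlinarith
  have hR2 : σ * G' ≤ (1.001 * ε + 4.01 * (K / t)) * (V * 2.68 * (4 + 4 * (C₁ * err))) := by
    calc σ * G' ≤ σ * (Vy * (4 + 4 * (C₁ * err))) := mul_le_mul_of_nonneg_left hG' hσ0
      _ ≤ (1.001 * ε + 4.01 * (K / t)) * (V * 2.68 * (4 + 4 * (C₁ * err))) := by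
          refine mul_le_mul hA3' ?_ (by positivity) (by positivity)
          exact mul_le_mul_of_nonneg_right hVy' (by positivity)
  have hεe : ε ≤ err := by linarith
  have hKe : K / t ≤ err := by linarith
  have hfs' : fs ≤ 4.006 * ε + 6 * (K / t) := by linarith
  have hprod : (1.001 * ε + 4.01 * (K / t)) * (C₁ * err) ≤ 0.337 * (C₁ * err) := by
    have : 1.001 * ε + 4.01 * (K / t) ≤ 0.337 := by nlinarith
    exact mul_le_mul_of_nonneg_right this hCe0
  have hR1 : VΔ * (C₁ * err) ≤ V * 1.34 * (C₁ * err) := mul_le_mul_of_nonneg_right hVΔ' hCe0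
  -- expand `hR2`
  have hR2' : σ * G' ≤ V * (10.8 * ε + 43 * (K / t) + 3.62 * (C₁ * err)) := by
    have hexp : (1.001 * ε + 4.01 * (K / t)) * (V * 2.68 * (4 + 4 * (C₁ * err))) =
        V * (10.72 * (1.001 * ε + 4.01 * (K / t)) + 10.72 * ((1.001 * ε + 4.01 * (K / t)) * (C₁ * err))) := by
      ring
    rw [hexp] at hR2
    refine hR2.trans (mul_le_mul_of_nonneg_left ?_ hV.le)
    nlinarith
  -- assemble
  have htot : fs + (1.34 * (C₁ * err) + (10.8 * ε + 43 * (K / t) + 3.62 * (C₁ * err))) ≤ E := by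
    have h66 : 4.006 * ε + 6 * (K / t) + 10.8 * ε + 43 * (K / t) ≤ 64 * err := by nlinarith
    have hC : 64 * err ≤ 0.04 * (C₁ * err) := by nlinarith
    nlinarith
  have : V * (fs - E) ≤ -(V * 1.34 * (C₁ * err)) - V * (10.8 * ε + 43 * (K / t) + 3.62 * (C₁ * err)) := by
    have := mul_le_mul_of_nonneg_left htot hV.le
    nlinarith
  linarith

/-! ### The error conversion -/

/-- `err = ε + ε⁻⁸ eᴷ/t ≤ 2 (ε + ε⁻⁸ e^{K+L} (log MN)^{−1/3})` for `log MN = τ t`, `1 ≤ τ ≤ 2`, `t ≥ 1`, `L ≥ 0`.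
[folklore] -/
theorem err_le_two_base {ε t K Lc τ LMN : ℝ} (hε : 0 < ε) (ht1 : 1 ≤ t) (hτ1 : 1 ≤ τ) (hτ2 : τ ≤ 2)
    (hLMN : LMN = τ * t) (hLc : 0 ≤ Lc) :
    ε + ε⁻¹ ^ 8 * Real.exp K / t ≤ 2 * (ε + ε⁻¹ ^ 8 * Real.exp (K + Lc) * LMN ^ (-(1 / 3 : ℝ))) := by
  have ht0 : 0 < t := by linarith
  have hL1 : 1 ≤ LMN := by rw [hLMN]; nlinarith
  have hL0 : 0 < LMN := by linarith
  have he : Real.exp K ≤ Real.exp (K + Lc) := Real.exp_le_exp.mpr (by linarith)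
  have h1 : 1 / t ≤ 2 * LMN ^ (-(1 / 3 : ℝ)) := by
    have h2 : 1 / t = τ / LMN := by rw [hLMN]; field_simp
    have h3 : τ / LMN ≤ 2 * LMN⁻¹ := by rw [div_eq_mul_inv]; exact mul_le_mul_of_nonneg_right hτ2 (by positivity)
    have h4 : LMN⁻¹ ≤ LMN ^ (-(1 / 3 : ℝ)) := by
      rw [← Real.rpow_neg_one]
      exact Real.rpow_le_rpow_of_exponent_le hL1 (by norm_num)
    rw [h2]; linarith
  have h5 : ε⁻¹ ^ 8 * Real.exp K / t = ε⁻¹ ^ 8 * Real.exp K * (1 / t) := by ring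
  rw [h5]
  have h6 : ε⁻¹ ^ 8 * Real.exp K * (1 / t) ≤ ε⁻¹ ^ 8 * Real.exp (K + Lc) * (2 * LMN ^ (-(1 / 3 : ℝ))) :=
    mul_le_mul (mul_le_mul_of_nonneg_left he (by positivity)) h1 (by positivity) (by positivity)
  nlinarith [h6, hε.le]

/-! ### The real branch (`log D₄ ≥ 900 ε⁻²`) -/

set_option maxHeartbeats 4000000 in
/-- **Theorem 1 in the real branch** (for `N ≤ M`): the rows are Iwaniec's coefficients of the outer
construction at level `D₄` (upper; lower for `z ≤ D_{j*}`) together with the Buchstab rows (lower, for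
`D_{j*} < z ≤ (MN)^{1/2}`); per `K` the main-term is estimated in the main or the crude regime.
[cite: IwaniecActaArith1980b, Theorem 1 and Lemma 2, p. 308 and p. 320] -/
theorem real_branch {Cd : ℝ} (hCd : 0 ≤ Cd)
    (hCdF : ∀ s : ℝ, 1 ≤ s → |upperSieveFun 1 s - 1| ≤ Cd * Real.exp (-s))
    (hCdf : ∀ s : ℝ, 2 ≤ s → |lowerSieveFun 1 s - 1| ≤ Cd * Real.exp (-s))
    {ε M N : ℝ} (hε : 0 < ε) (hε3 : ε < 1 / 3) (hN : 1 < N) (hNM : N ≤ M)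
    (ht9 : 900 * ε⁻¹ ^ 2 ≤ Real.log (levD ε M N)) :
    ∃ (L : ℕ) (au bu al bl : ℕ → ℕ → ℝ),
      (L : ℝ) ≤ Real.exp (8 * ε⁻¹ ^ 3) ∧
      (∀ l m, |au l m| ≤ 1) ∧ (∀ l n, |bu l n| ≤ 1) ∧ (∀ l m, |al l m| ≤ 1) ∧ (∀ l n, |bl l n| ≤ 1) ∧
      ∀ (B : Multiset ℤ) (X : ℝ) (ω : ArithmeticFunction ℝ) (K Lc : ℝ),
        0 < X → ω.IsMultiplicative → (∀ n, 0 ≤ ω n) → (∀ p : ℕ, p.Prime → ω p < p) →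
        1 ≤ K → 1 ≤ Lc →
        (∀ w z : ℝ, 2 ≤ w → w < z →
          ∏ p ∈ (Nat.primesBelow ⌈z⌉₊).filter (fun p : ℕ => w ≤ (p : ℝ)), (1 - ω p / p)⁻¹ ≤
            Real.log z / Real.log w * (1 + K / Real.log w)) →
        ∀ z : ℝ, 2 ≤ z → z ≤ (M * N) ^ (1 / 2 : ℝ) →
          let s : ℝ := Real.log (M * N) / Real.log z
          let E : ℝ := 1e29 * (1 + Cd) ^ 2 * (ε + ε⁻¹ ^ 8 * Real.exp (K + Lc) * Real.log (M * N) ^ (-(1 / 3 : ℝ)))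
          let V : ℝ := ∏ p ∈ Nat.primesBelow ⌈z⌉₊, (1 - ω p / p)
          let r : ℕ → ℝ := fun d => (mcount B d : ℝ) - ω d / d * X
          let R : (ℕ → ℕ → ℝ) → (ℕ → ℕ → ℝ) → ℝ := fun a b =>
            ∑ l ∈ Finset.range L, ∑ m ∈ Finset.Ico 1 ⌈M⌉₊, ∑ n ∈ Finset.Ico 1 ⌈N⌉₊,
              if m * n ∣ primesProdBelow z then a l m * b l n * r (m * n) else 0
          (msifted B z : ℝ) ≤ V * X * (upperSieveFun 1 s + E) + R au bu ∧
            V * X * (lowerSieveFun 1 s - E) - R al bl ≤ (msifted B z : ℝ) := by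
  have hε3' : ε ≤ 1 / 3 := hε3.le
  obtain ⟨hD, hlogD⟩ := levD_basic hε hε3' hN hNM
  obtain ⟨hη, hηε, hτ1, hτ2, hτε⟩ := tau_bounds hε hε3'
  have hτ0 : tauP ε ≠ 0 := by linarith only [hτ1]
  obtain ⟨hNb1, hNbpow, hMbNb, hMb1, hDM⟩ := params_spec hε hε3' hN hNM
  have hsqD := sqrt_le_levD hε hε3' hN hNM
  set D := levD ε M N with hDdef
  set Mb := MbP ε M N with hMbdef
  set Nb := NbP ε N with hNbdef
  set t := Real.log D with htdef
  have hlogDt : Real.log D = t := rfl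
  have hD0 : 0 < D := by linarith
  have hεi : 3 ≤ ε⁻¹ := by rw [le_inv_comm₀ (by norm_num) hε]; linarith
  have ht : 8100 ≤ t := le_trans (by nlinarith only [hεi]) ht9
  have ht1 : 1 ≤ t := by linarith only [ht]
  have ht0 : 0 < t := by linarith only [ht]
  have hMN1 : 1 < M * N := by nlinarith only [hN, hNM]
  have hLMN : Real.log (M * N) = tauP ε * t := by
    rw [hlogD]; field_simp
  -- geometry of the top box and the inner level
  obtain ⟨hj1, hΔle, hΔsq, hlogΔ1, hlogΔ2, hD4Δ, h2Δ⟩ := topBox_spec hD hε hε3' ht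
  set jst := Core.jstar hD hε with hjst
  set Δ := grid D ε (Core.eta ε) jst with hΔdef
  have hj₀ : jst - 1 + 1 = jst := Nat.sub_add_cancel hj1
  have hΔdef' : Δ = grid D ε (Core.eta ε) (jst - 1 + 1) := by rw [hj₀]
  have hΔsq' : grid D ε (Core.eta ε) (jst - 1 + 1) ^ 2 ≤ D := by rw [hj₀]; exact hΔsq
  have hΔD : Δ ≤ D := by nlinarith only [hΔsq, h2Δ]
  set D' := D ^ (1 / 4 : ℝ) with hD'def
  have hlogD' : Real.log D' = t / 4 := by rw [hD'def, Real.log_rpow hD0]; ring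
  have hD' : 1 < D' := Real.one_lt_rpow hD (by norm_num)
  have hD'0 : 0 < D' := by linarith
  have htwo : ∀ {x : ℝ}, 0 < x → 1 ≤ Real.log x → 2 ≤ x := fun {x} hx hl => by
    have : Real.log 2 ≤ Real.log x := by have := Real.log_two_lt_d9; linarith
    exact (Real.log_le_log_iff two_pos hx).mp this
  have hD'2 : 2 ≤ D' := htwo hD'0 (by rw [hlogD']; linarith)
  have hD2 : 2 ≤ D := htwo hD0 (by linarith)
  have hD'Δ : D' ≤ Δ := hD4Δ
  -- counts
  set L₁ := Core.Lone ε with hL₁def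
  have hL₁ : (Core.Univ hD hε).card ≤ L₁ := Core.card_Univ_le hD hε hD2
  have hL₁' : (Core.Univ hD' hε).card ≤ L₁ := Core.card_Univ_le hD' hε hD'2
  set cA' : Bool := decide (⌈Core.innerA D' ε⌉₊ ≤ ⌈N⌉₊) with hcA'
  refine ⟨L₁ + L₁, Core.cA hD hε 1 (jst - 1) Mb, Core.cB hD hε Mb, alRow hD hε hD' (jst - 1) Mb cA' L₁,
    blRow hD hε hD' Mb cA' L₁, ?_, fun l m => Core.abs_cA_le_one hD hε 1 _ Mb l m,
    fun l n => Core.abs_cB_le_one hD hε Mb l n,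
    fun l m => abs_alRow_le_one hD hε hD' hε3' _ Mb cA' L₁ (by rw [hj₀]; exact hD'Δ) l m,
    fun l n => abs_blRow_le_one hD hε hD' Mb cA' L₁ l n, ?_⟩
  · have := Core.two_Lone_add_two_le hε hε3'
    push_cast; linarith
  intro B X ω K Lc hX hω hω0 hωp hK1 hLc h1 z hz2 hzMN s E V r R
  -- the density
  set g := densityOf ω with hgdef
  have hg : g.IsMultiplicative := isMultiplicative_densityOf hω
  have h01 : ∀ p : ℕ, p.Prime → 0 ≤ g p ∧ g p < 1 := densityOf_prime_bounds hω0 hωp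
  have h1g : ∀ w z : ℝ, 2 ≤ w → w < z →
      ∏ p ∈ (Nat.primesBelow ⌈z⌉₊).filter (fun p : ℕ => w ≤ (p : ℝ)), (1 - g p)⁻¹ ≤
        Real.log z / Real.log w * (1 + K / Real.log w) := h1
  have hK0 : 0 ≤ K := by linarith
  have hVpos : ∀ y : ℝ, 0 < BetaSieve.vprod g (primesProdBelow y) := fun y =>
    vprod_pos_of_lt_one fun p hp => (h01 p (Nat.prime_of_mem_primeFactors hp)).2
  have hVeq : BetaSieve.vprod g (primesProdBelow z) = V := vprod_densityOf_eq ω z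
  have hV0 : 0 < V := hVeq ▸ hVpos z
  have hzD : z ≤ D := hzMN.trans hsqD
  have hzM : z ≤ M := hzMN.trans (by
    have hM0 : (0:ℝ) ≤ M := by linarith
    calc (M * N) ^ (1 / 2 : ℝ) ≤ (M * M) ^ (1 / 2 : ℝ) :=
          Real.rpow_le_rpow (by positivity) (by nlinarith only [hN, hNM]) (by norm_num)
      _ = M := by
          rw [show M * M = M ^ (2:ℝ) by rw [Real.rpow_two, sq], ← Real.rpow_mul hM0]; norm_num)
  have hz0 : 0 < z := by linarith
  have hlogz0 : 0 < Real.log z := Real.log_pos (by linarith)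
  have hlogzt : Real.log z ≤ t := Real.log_le_log hz0 hzD
  have hlogz2 : Real.log z ≤ tauP ε * t / 2 := by
    have := Real.log_le_log hz0 hzMN
    rw [Real.log_rpow (by linarith), hLMN] at this; linarith
  -- `s = τ s₄`, `s₄ = t/log z ≥ 1`
  have hs : s = tauP ε * t / Real.log z := by show Real.log (M * N) / Real.log z = _; rw [hLMN]
  set s₄ := t / Real.log z with hs₄
  have hs₄1 : 1 ≤ s₄ := by rw [hs₄, le_div_iff₀ hlogz0]; linarith
  have hss₄ : s = tauP ε * s₄ := by rw [hs, hs₄]; ring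
  have hs2 : 2 ≤ s := by rw [hs, le_div_iff₀ hlogz0]; linarith
  have hlogτ : Real.log (s / s₄) ≤ 2 * ε := by
    rw [hss₄, mul_div_assoc, div_self (by positivity), mul_one]
    have := Real.log_le_sub_one_of_pos (by linarith : 0 < tauP ε); linarith
  -- the errors
  set err := ε + ε⁻¹ ^ 8 * Real.exp K / t with herr
  have herr0 : 0 ≤ err := by positivity
  have hKerr : ε + K / t ≤ err := by
    have h1' : K ≤ ε⁻¹ ^ 8 * Real.exp K := by
      have he8 : 1 ≤ ε⁻¹ ^ 8 := one_le_pow₀ (by linarith)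
      have hKe : K ≤ Real.exp K := by linarith [Real.add_one_le_exp K]
      nlinarith only [he8, hKe, Real.exp_pos K, hK1]
    have := div_le_div_of_nonneg_right h1' ht0.le
    rw [herr]; linarith only [this]
  have hεerr : ε ≤ err := by
    have : 0 ≤ K / t := by positivity
    linarith only [this, hKerr]
  have hbase := err_le_two_base (K := K) hε ht1 hτ1.le hτ2 hLMN (by linarith : 0 ≤ Lc)
  rw [← herr] at hbase
  set C₁ := 5e24 * (1 + Cd) ^ 2 with hC₁
  have hC₁5 : 5e24 ≤ C₁ := by rw [hC₁]; nlinarith only [hCd]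
  have hC0 : 0 ≤ C₁ := by linarith only [hC₁5]
  set base := ε + ε⁻¹ ^ 8 * Real.exp (K + Lc) * Real.log (M * N) ^ (-(1 / 3 : ℝ)) with hbase_def
  have hE : E = 1e29 * (1 + Cd) ^ 2 * base := rfl
  have hsq1 : (1:ℝ) ≤ (1 + Cd) ^ 2 := by nlinarith only [hCd]
  have hb0 : 0 ≤ base := by linarith only [hbase, herr0]
  have hEC : 1e4 * C₁ * err ≤ E := by
    rw [hE, hC₁]
    have := mul_le_mul_of_nonneg_left hbase (sq_nonneg (1 + Cd))
    linarith only [this]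
  have hE28 : 1e28 * err ≤ E := by
    rw [hE]
    have := mul_le_mul_of_nonneg_right hsq1 hb0
    linarith only [hbase, this, hb0]
  have hCe0 : 0 ≤ C₁ * err := mul_nonneg hC0 herr0
  -- the remainder and the sieve identity
  have hr : ∀ d, (mcount B d : ℝ) = g d * X + r d := fun d => by
    show (mcount B d : ℝ) = densityOf ω d * X + ((mcount B d : ℝ) - ω d / d * X)
    rw [densityOf_apply]; ring
  have hsplit : ∀ (Λ : ℕ → ℝ) (S : Finset ℕ), ∑ d ∈ S, Λ d * (mcount B d : ℝ) =
      X * ∑ d ∈ S, Λ d * g d + ∑ d ∈ S, Λ d * r d := fun Λ S => by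
    rw [Finset.mul_sum, ← Finset.sum_add_distrib]
    exact Finset.sum_congr rfl fun d _ => by rw [hr d]; ring
  -- the main-term bounds at level `D`
  have hreg := fun {y : ℝ} (hy : 2 ≤ y) (hyD : y ≤ D) =>
    regime_bounds_all hD hε hε3' hg hK1 h1g h01 hCd hCdF hCdf hy hyD
  constructor
  · ---------------------------------------------------------------- upper bound
    have hS := (Core.sieve_bounds_LamZ hD hε z B).1
    have hid := Core.sum_LamZ_mul_eq_bilinear hD hε hε3' 1 (jst - 1) hΔsq' hMb1 hNb1 hMbNb
      (le_of_eq hDM) (le_of_eq hNbpow) hN (L := L₁ + L₁) (by omega) hzD (fun h => absurd h (by norm_num)) r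
    have hG := (hreg hz2 hzD).1
    rw [hVeq, hlogDt, ← herr, ← hs₄, ← hC₁] at hG
    -- `F₁(s₄) ≤ F₁(s) + (5 + 2C_d) · 2ε`
    have hF : upperSieveFun 1 s₄ ≤ upperSieveFun 1 s + (5 + 2 * Cd) * (2 * ε) := by
      have h := abs_upperSieveFun_sub_le hCd hCdF hCdf hs₄1 (b := s) (by rw [hss₄]; nlinarith only [hτ1, hs₄1])
      have := (abs_le.mp h).1
      linarith only [this, mul_le_mul_of_nonneg_left hlogτ (by linarith only [hCd] : (0:ℝ) ≤ 5 + 2 * Cd)]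
    have hmain : ∑ d ∈ (primesProdBelow z).divisors, Core.LamZ hD hε 1 z d * g d ≤
        V * (upperSieveFun 1 s + E) := by
      refine hG.trans (mul_le_mul_of_nonneg_left ?_ hV0.le)
      have h2C : (5 + 2 * Cd) * 2 ≤ C₁ := by rw [hC₁]; nlinarith only [hCd]
      have hint := mul_le_mul h2C hεerr hε.le hC0
      linarith only [hF, hint, hEC, hCe0]
    calc (msifted B z : ℝ) ≤ ∑ d ∈ (primesProdBelow z).divisors, Core.LamZ hD hε 1 z d * (mcount B d : ℝ) := hS
      _ = X * ∑ d ∈ (primesProdBelow z).divisors, Core.LamZ hD hε 1 z d * g d +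
            ∑ d ∈ (primesProdBelow z).divisors, Core.LamZ hD hε 1 z d * r d := hsplit _ _
      _ ≤ X * (V * (upperSieveFun 1 s + E)) + R (Core.cA hD hε 1 (jst - 1) Mb) (Core.cB hD hε Mb) := by
          rw [hid]; exact add_le_add (mul_le_mul_of_nonneg_left hmain hX.le) le_rfl
      _ = V * X * (upperSieveFun 1 s + E) + R (Core.cA hD hε 1 (jst - 1) Mb) (Core.cB hD hε Mb) := by ring
  · ---------------------------------------------------------------- lower bound
    -- the two blocks of the lower rows
    have hR : R (alRow hD hε hD' (jst - 1) Mb cA' L₁) (blRow hD hε hD' Mb cA' L₁) =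
        -(∑ d ∈ (primesProdBelow (min z Δ)).divisors, Core.LamZ hD hε 0 (min z Δ) d * r d) +
          ∑ p ∈ (Nat.primesBelow ⌈z⌉₊).filter (fun p : ℕ => Δ ≤ (p : ℝ)),
            ∑ d ∈ (primesProdBelow D').divisors, Core.LamZ hD' hε 1 D' d * r (p * d) := by
      show ∑ l ∈ Finset.range (L₁ + L₁), _ = _
      rw [Finset.sum_range_add]
      congr 1
      · rw [hΔdef', ← outer_lower_rows_eval hD hε hε3' (jst - 1) hΔsq' hMb1 hNb1 hMbNb (le_of_eq hDM)
          (le_of_eq hNbpow) hN hL₁ hzD r]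
        refine Finset.sum_congr rfl fun l hl => ?_
        rw [Finset.mem_range] at hl
        simp only [alRow, blRow, if_pos hl]
      · have hcase : (cA' = true ∧ ⌈Core.innerA D' ε⌉₊ ≤ ⌈N⌉₊) ∨ (cA' = false ∧ z * Core.innerA D' ε ≤ M) := by
          by_cases hc : ⌈Core.innerA D' ε⌉₊ ≤ ⌈N⌉₊
          · exact Or.inl ⟨by rw [hcA']; exact decide_eq_true hc, hc⟩
          · refine Or.inr ⟨by rw [hcA']; exact decide_eq_false hc, ?_⟩
            -- `N < A' = (MN)^{1/4}` gives `z A' ≤ (MN)^{3/4} ≤ M`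
            have hA' : Core.innerA D' ε = (M * N) ^ (1 / 4 : ℝ) := by
              rw [Core.innerA, ← Real.rpow_add hD'0, show ε + (1 + Core.eta ε) = tauP ε by rw [tauP]; ring,
                hD'def, ← Real.rpow_mul hD0.le, hDdef, levD, ← Real.rpow_mul (by linarith)]
              congr 1; field_simp
            have hNA : N ≤ (M * N) ^ (1 / 4 : ℝ) := by
              by_contra hlt
              push Not at hlt
              apply hc
              rw [hA']
              exact Nat.ceil_mono hlt.le
            have hMN0 : (0:ℝ) ≤ M * N := by linarith
            calc z * Core.innerA D' ε ≤ (M * N) ^ (1 / 2 : ℝ) * (M * N) ^ (1 / 4 : ℝ) := by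
                  rw [hA']; exact mul_le_mul_of_nonneg_right hzMN (by positivity)
              _ = (M * N) ^ (3 / 4 : ℝ) := by rw [← Real.rpow_add (by linarith)]; norm_num
              _ ≤ M := by
                  -- `(MN)^{3/4} ≤ M ⟺ N³ ≤ M`, and `N ≤ (MN)^{1/4}` gives `N⁴ ≤ MN`
                  have hN4 : N ^ (4:ℕ) ≤ M * N := by
                    have := pow_le_pow_left₀ (by linarith) hNA 4
                    have h4 : ((M * N) ^ (1 / 4 : ℝ)) ^ (4:ℕ) = M * N := by
                      rw [← Real.rpow_natCast, ← Real.rpow_mul hMN0]; norm_num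
                    rwa [h4] at this
                  have hNpos : 0 < N := by linarith only [hN]
                  have hN3 : N ^ 3 ≤ M := by
                    have h' : N ^ 3 * N ≤ M * N := by
                      calc N ^ 3 * N = N ^ (4:ℕ) := by ring
                        _ ≤ M * N := hN4
                    exact le_of_mul_le_mul_right h' hNpos
                  have h34 : ((M * N) ^ (3 / 4 : ℝ)) ^ (4:ℕ) = (M * N) ^ 3 := by
                    rw [← Real.rpow_natCast, ← Real.rpow_mul hMN0]; norm_num
                  have hM0 : (0:ℝ) ≤ M := by linarith only [hN, hNM]
                  have hM4 : (M * N) ^ 3 ≤ M ^ (4:ℕ) := by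
                    calc (M * N) ^ 3 = M ^ 3 * N ^ 3 := by ring
                      _ ≤ M ^ 3 * M := mul_le_mul_of_nonneg_left hN3 (pow_nonneg hM0 3)
                      _ = M ^ (4:ℕ) := by ring
                  by_contra hlt
                  push Not at hlt
                  have := pow_lt_pow_left₀ hlt hM0 (by norm_num : (4:ℕ) ≠ 0)
                  rw [h34] at this; linarith only [this, hM4]
        rw [buchstab_rows_eval hD hε hD' hε3' (jst - 1) hΔdef' hD'Δ hzM hN cA' hcase hL₁' Mb r]
    -- common lower-bound facts
    have hf1 : lowerSieveFun 1 s ≤ 1 := (lowerSieveFun_bounds hCd hCdf hs2).1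
    rcases le_or_gt z Δ with hzΔ | hΔz
    · ------------------------------------------------------------ `z ≤ Δ`
      have hmin : min z Δ = z := min_eq_left hzΔ
      have hT : (Nat.primesBelow ⌈z⌉₊).filter (fun p : ℕ => Δ ≤ (p : ℝ)) = ∅ := by
        refine Finset.filter_false_of_mem fun p hp => ?_
        rw [Nat.mem_primesBelow] at hp
        have : (p : ℝ) < z := Nat.lt_ceil.mp hp.1
        push Not; linarith
      rw [hmin, hT, Finset.sum_empty, add_zero] at hR
      have hS := (Core.sieve_bounds_LamZ hD hε z B).2
      have hz2D : z ^ 2 ≤ D := le_trans (pow_le_pow_left₀ hz0.le hzΔ 2) hΔsq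
      have hG := (hreg hz2 hzD).2 hz2D
      rw [hVeq, hlogDt, ← herr, ← hs₄, ← hC₁] at hG
      -- `f₁(s₄) ≥ f₁(s) − (18 + 4C_d) ε`
      have hf : lowerSieveFun 1 s - (18 + 4 * Cd) * ε ≤ lowerSieveFun 1 s₄ := by
        have hτs : tauP ε * s₄ ≤ tauP ε * 2 ∨ 2 < s₄ := by
          rcases le_or_gt s₄ 2 with h | h
          · exact Or.inl (mul_le_mul_of_nonneg_left h (by linarith only [hτ1]))
          · exact Or.inr h
        rcases hτs with hτs | hs₄2
        · have hs₄2 : s₄ ≤ 2 := le_of_mul_le_mul_left hτs (by linarith only [hτ1])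
          have h0 : lowerSieveFun 1 s₄ = 0 :=
            isLinearSieveFunctions_std.lower_eq_zero (by linarith only [hs₄1]) hs₄2
          have hs4 : s ≤ 4 := by rw [hss₄]; linarith only [hτs, hτ2]
          have hfle := lowerSieveFun_le_two_mul hs2 hs4
          have hs2ε : s - 2 ≤ 4 * ε := by rw [hss₄]; linarith only [hτs, hτε]
          linarith only [hfle, hs2ε, h0, mul_nonneg hCd hε.le, hε.le]
        · have h := lowerSieveFun_sub_le hCd hCdF hCdf hs₄2 (b := s) (by rw [hss₄]; nlinarith only [hτ1, hs₄1])
          linarith only [h, mul_le_mul_of_nonneg_left hlogτ (by linarith only [hCd] : (0:ℝ) ≤ 5 + 2 * Cd),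
            mul_nonneg hCd hε.le, hε.le]
      have hmain : V * (lowerSieveFun 1 s - E) ≤ ∑ d ∈ (primesProdBelow z).divisors, Core.LamZ hD hε 0 z d * g d := by
        refine le_trans (mul_le_mul_of_nonneg_left ?_ hV0.le) hG
        have h2C : (18 + 4 * Cd) ≤ C₁ := by rw [hC₁]; nlinarith only [hCd]
        have hint := mul_le_mul h2C hεerr hε.le hC0
        linarith only [hf, hint, hEC, hCe0]
      have hSid := hsplit (fun d => Core.LamZ hD hε 0 z d) (primesProdBelow z).divisors
      calc V * X * (lowerSieveFun 1 s - E) - R (alRow hD hε hD' (jst - 1) Mb cA' L₁) (blRow hD hε hD' Mb cA' L₁)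
          = X * (V * (lowerSieveFun 1 s - E)) +
              ∑ d ∈ (primesProdBelow z).divisors, Core.LamZ hD hε 0 z d * r d := by rw [hR]; ring
        _ ≤ X * ∑ d ∈ (primesProdBelow z).divisors, Core.LamZ hD hε 0 z d * g d +
              ∑ d ∈ (primesProdBelow z).divisors, Core.LamZ hD hε 0 z d * r d :=
            add_le_add (mul_le_mul_of_nonneg_left hmain hX.le) le_rfl
        _ = ∑ d ∈ (primesProdBelow z).divisors, Core.LamZ hD hε 0 z d * (mcount B d : ℝ) := hSid.symm
        _ ≤ (msifted B z : ℝ) := hS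
    · ------------------------------------------------------------ `Δ < z`: Buchstab
      have hmin : min z Δ = Δ := min_eq_right hΔz.le
      rw [hmin] at hR
      set T := (Nat.primesBelow ⌈z⌉₊).filter (fun p : ℕ => Δ ≤ (p : ℝ)) with hT
      set G0 := ∑ d ∈ (primesProdBelow Δ).divisors, Core.LamZ hD hε 0 Δ d * g d with hG0def
      set G' := ∑ d ∈ (primesProdBelow D').divisors, Core.LamZ hD' hε 1 D' d * g d with hG'def
      set σ := ∑ p ∈ T, g p with hσdef
      set VΔ := BetaSieve.vprod g (primesProdBelow Δ) with hVΔdef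
      set Vy := BetaSieve.vprod g (primesProdBelow D') with hVydef
      have hVΔ0 : 0 < VΔ := hVpos Δ
      have hVy0 : 0 < Vy := hVpos D'
      have hTp : ∀ p ∈ T, p.Prime ∧ (p : ℝ) < z ∧ Δ ≤ (p : ℝ) := fun p hp => by
        rw [hT, Finset.mem_filter, Nat.mem_primesBelow] at hp
        exact ⟨hp.1.2, Nat.lt_ceil.mp hp.1.1, hp.2⟩
      have hσ0 : 0 ≤ σ := Finset.sum_nonneg fun p hp => (h01 p (hTp p hp).1).1
      -- Buchstab and the two sieves
      have hBu := card_sifted_buchstab B z (y₁ := D') hD'Δ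
      have hSΔ := (Core.sieve_bounds_LamZ hD hε Δ B).2
      have hSp : ∀ p ∈ T,
          (((B.filter fun b : ℤ => (p : ℤ) ∣ b).filter fun b : ℤ => Int.gcd b (primesProdBelow D') = 1).card : ℝ) ≤
            X * g p * G' + ∑ d ∈ (primesProdBelow D').divisors, Core.LamZ hD' hε 1 D' d * r (p * d) := by
        intro p hp
        obtain ⟨hpp, hpz, hpΔ⟩ := hTp p hp
        have h := (Core.sieve_bounds_LamZ hD' hε D' (B.filter fun b : ℤ => (p : ℤ) ∣ b)).1
        refine h.trans (le_of_eq ?_)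
        rw [hG'def, Finset.mul_sum, ← Finset.sum_add_distrib]
        refine Finset.sum_congr rfl fun d hd => ?_
        have hdsq : Squarefree d := (squarefree_primesProdBelow D').squarefree_of_dvd (Nat.dvd_of_mem_divisors hd)
        have hcop : Nat.Coprime p d := by
          rw [Nat.Prime.coprime_iff_not_dvd hpp]
          intro hpd
          have := (dvd_primesProdBelow_iff hpp D').mp (hpd.trans (Nat.dvd_of_mem_divisors hd))
          linarith
        rw [card_filter_filter_dvd B hcop]
        have hm : (mcount B (p * d) : ℝ) = g (p * d) * X + r (p * d) := hr (p * d)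
        rw [show ((B.filter fun b : ℤ => ((p * d : ℕ) : ℤ) ∣ b).card : ℝ) = (mcount B (p * d) : ℝ) from rfl, hm,
          hg.map_mul_of_coprime hcop]
        ring
      have hSsum : ∑ p ∈ T,
          (((B.filter fun b : ℤ => (p : ℤ) ∣ b).filter fun b : ℤ => Int.gcd b (primesProdBelow D') = 1).card : ℝ) ≤
            X * σ * G' + ∑ p ∈ T, ∑ d ∈ (primesProdBelow D').divisors, Core.LamZ hD' hε 1 D' d * r (p * d) := by
        refine (Finset.sum_le_sum hSp).trans (le_of_eq ?_)
        have e1 : ∑ p ∈ T, X * g p * G' = X * σ * G' := by rw [← Finset.sum_mul, ← Finset.mul_sum, hσdef]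
        rw [Finset.sum_add_distrib, e1]
      -- the key inequality `V (f₁(s) − E) ≤ G0 − σ G'`
      have hkey : V * (lowerSieveFun 1 s - E) ≤ G0 - σ * G' := by
        -- `V(Δ), V(y₁)` versus `V(z)`
        have hVzΔ : V = VΔ * BetaSieve.vprod g (primesProdIco Δ z) := by
          rw [← hVeq]; exact vprod_primesProdBelow_mul hΔz.le
        have hVzy : V = Vy * BetaSieve.vprod g (primesProdIco D' z) := by
          rw [← hVeq]; exact vprod_primesProdBelow_mul (hD'Δ.trans hΔz.le)
        have hIΔ0 : 0 < BetaSieve.vprod g (primesProdIco Δ z) :=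
          vprod_pos_of_lt_one fun p hp => (h01 p (Nat.prime_of_mem_primeFactors hp)).2
        have hIy0 : 0 < BetaSieve.vprod g (primesProdIco D' z) :=
          vprod_pos_of_lt_one fun p hp => (h01 p (Nat.prime_of_mem_primeFactors hp)).2
        have hIΔ1 : BetaSieve.vprod g (primesProdIco Δ z) ≤ 1 := vprod_Ico_le_one h01 _ _
        have hIy1 : BetaSieve.vprod g (primesProdIco D' z) ≤ 1 := vprod_Ico_le_one h01 _ _
        have hVVΔ : V ≤ VΔ := by rw [hVzΔ]; exact mul_le_of_le_one_right hVΔ0.le hIΔ1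
        have hVVy : V ≤ Vy := by rw [hVzy]; exact mul_le_of_le_one_right hVy0.le hIy1
        by_cases hcrude : Real.log D < 200 * K * ε⁻¹ ^ 2 ∨ Real.log D < 4e4 * K ^ 2 ∨ Real.log D < 900 * ε⁻¹ ^ 2 ∨
            (Real.log D ≤ ε⁻¹ ^ 4 ∧ 1 / 30 < ε)
        · -- crude: `G0 ≥ −V(Δ)⁻¹ ≥ −V⁻¹`, `G' ≤ V(y₁)⁻¹ ≤ V⁻¹`, `σ ≤ V⁻¹`, `E ≥ 1 + V⁻² + V⁻³`
          have hG0c : -V⁻¹ ≤ G0 := by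
            have := (abs_le.mp (Core.abs_mainSum_LamZ_le hD hε hg h01 0 Δ)).1
            have : VΔ⁻¹ ≤ V⁻¹ := inv_anti₀ hV0 hVVΔ
            linarith
          have hG'c : G' ≤ V⁻¹ := by
            have := (abs_le.mp (Core.abs_mainSum_LamZ_le hD' hε hg h01 1 D')).2
            have : Vy⁻¹ ≤ V⁻¹ := inv_anti₀ hV0 hVVy
            linarith
          have hσc : σ ≤ V⁻¹ := by
            have hsub : T ⊆ (primesProdBelow z).divisors := fun p hp => by
              obtain ⟨hpp, hpz, -⟩ := hTp p hp
              exact Nat.mem_divisors.mpr ⟨(dvd_primesProdBelow_iff hpp z).mpr hpz, primesProdBelow_ne_zero z⟩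
            calc σ ≤ ∑ d ∈ (primesProdBelow z).divisors, g d :=
                  Finset.sum_le_sum_of_subset_of_nonneg hsub fun d hd _ =>
                    Core.g_nonneg_of_dvd h01 (squarefree_primesProdBelow z) hg hd
              _ ≤ V⁻¹ := by
                  rw [← hVeq]
                  exact BetaSieve.sum_divisors_le_vprod_inv hg (squarefree_primesProdBelow z)
                    fun p hp => h01 p (Nat.prime_of_mem_primeFactors hp)
          have hEc : 1 + V⁻¹ ^ 2 + V⁻¹ ^ 3 ≤ E := by
            have h := Core.crude_inv_vprod_bound hD hε hK1 h1g hε3' hcrude hVpos hz2 hzD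
            rw [hVeq, hlogDt, ← herr] at h
            linarith
          have hVi0 : 0 ≤ V⁻¹ := inv_nonneg.mpr hV0.le
          have h1 : σ * G' ≤ V⁻¹ * V⁻¹ := by
            rcases le_or_gt 0 G' with hG'0 | hG'0
            · exact mul_le_mul hσc hG'c hG'0 hVi0
            · linarith only [mul_le_mul_of_nonneg_left hG'0.le hσ0, mul_nonneg hVi0 hVi0]
          have h2 : V * (lowerSieveFun 1 s - E) ≤ V * (1 - E) :=
            mul_le_mul_of_nonneg_left (by linarith only [hf1]) hV0.le
          have h3 : V * (1 - E) ≤ -V⁻¹ - V⁻¹ * V⁻¹ := by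
            have := mul_le_mul_of_nonneg_left hEc hV0.le
            have e1 : V * (1 + V⁻¹ ^ 2 + V⁻¹ ^ 3) = V + V⁻¹ + V⁻¹ * V⁻¹ := by field_simp
            linarith only [this, e1]
          linarith only [h1, h2, h3, hG0c]
        · -- main regime at level `D`
          push Not at hcrude
          obtain ⟨hc1, -, -, -⟩ := hcrude
          have hKt : 200 * K ≤ ε ^ 2 * t := by
            have := mul_le_mul_of_nonneg_left hc1 (by positivity : (0:ℝ) ≤ ε ^ 2)
            rw [show ε ^ 2 * (200 * K * ε⁻¹ ^ 2) = 200 * K by field_simp] at this; exact this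
          -- geometry
          have hΔpos : 0 < Δ := by linarith
          have hlogΔz : Real.log Δ < Real.log z := Real.log_lt_log hΔpos hΔz
          have hlogΔ' : Real.log Δ ≤ t / 2 := by
            have := Real.log_le_log hΔpos hΔle
            rw [Real.log_sqrt hD0.le] at this; linarith
          have hlogΔ1' : t / 2 - 0.6932 ≤ (1 + Core.eta ε) * Real.log Δ := by
            have := Real.log_two_lt_d9; linarith
          have hsform : s = (1 + ε + Core.eta ε) * t / Real.log z := by rw [hs]; rfl
          obtain ⟨hLΔ0, h1335, hdiff, h201, -, hs3⟩ :=
            buchstab_geometry hε hε3' hη.le hηε ht hlogΔ1' hlogΔ' hlogz2 hlogΔz hsform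
          have hs4 : s ≤ 4 := by
            have : 3 / t ≤ 1 := by rw [div_le_iff₀ ht0]; linarith
            linarith
          have hfs := lowerSieveFun_le_two_mul hs2 hs4
          -- `V(Δ) ≤ V · A₁`, `V(y₁) ≤ V · A₂`
          have hVΔb : VΔ ≤ V * (Real.log z / Real.log Δ * (1 + K / Real.log Δ)) := by
            have hi := inv_vprod_Ico_le (g := g) (K := K) h1g h2Δ hΔz
            calc VΔ = V * (BetaSieve.vprod g (primesProdIco Δ z))⁻¹ := by
                  rw [hVzΔ]; field_simp
              _ ≤ _ := mul_le_mul_of_nonneg_left hi hV0.le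
          have hVyb : Vy ≤ V * (Real.log z / (t / 4) * (1 + K / (t / 4))) := by
            have hi := inv_vprod_Ico_le (g := g) (K := K) h1g hD'2 (lt_of_le_of_lt hD'Δ hΔz)
            rw [hlogD'] at hi
            calc Vy = V * (BetaSieve.vprod g (primesProdIco D' z))⁻¹ := by
                  rw [hVzy]; field_simp
              _ ≤ _ := mul_le_mul_of_nonneg_left hi hV0.le
          have hσb : σ ≤ (Real.log z - Real.log Δ + K) / Real.log Δ :=
            BetaSieve.sum_primes_Ico_le hK0 h1g h01 h2Δ hΔz
          -- `G0 ≥ −V(Δ) C₁ err`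
          have hG0b : -(VΔ * (C₁ * err)) ≤ G0 := by
            have h := ((hreg h2Δ hΔD).2 hΔsq)
            rw [hlogDt, ← herr, ← hC₁] at h
            have hf0 : 0 ≤ lowerSieveFun 1 (t / Real.log Δ) :=
              lowerSieveFun_one_nonneg (by rw [le_div_iff₀ hLΔ0]; linarith)
            have : VΔ * (0 - C₁ * err) ≤ VΔ * (lowerSieveFun 1 (t / Real.log Δ) - C₁ * err) :=
              mul_le_mul_of_nonneg_left (by linarith only [hf0]) hVΔ0.le
            have e : VΔ * (0 - C₁ * err) = -(VΔ * (C₁ * err)) := by ring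
            linarith only [h, this, e]
          -- `G' ≤ V(y₁)(4 + 4 C₁ err)`
          have hG'b : G' ≤ Vy * (4 + 4 * (C₁ * err)) := by
            have h := (regime_bounds_all hD' hε hε3' hg hK1 h1g h01 hCd hCdF hCdf hD'2 le_rfl).1
            rw [div_self (Real.log_pos hD').ne', hlogD', ← hC₁] at h
            have hF1 : upperSieveFun 1 1 ≤ 4 := by
              rw [upperSieveFun_one_eq_holds ⟨one_pos, by norm_num⟩, div_one]; exact two_exp_gamma_le_four
            have herr4 : ε + ε⁻¹ ^ 8 * Real.exp K / (t / 4) ≤ 4 * err := by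
              rw [herr]
              have : ε⁻¹ ^ 8 * Real.exp K / (t / 4) = 4 * (ε⁻¹ ^ 8 * Real.exp K / t) := by field_simp
              rw [this]; linarith only [hε.le]
            refine h.trans (mul_le_mul_of_nonneg_left ?_ hVy0.le)
            linarith only [hF1, mul_le_mul_of_nonneg_left herr4 hC0]
          have hlogz2' : Real.log z ≤ (1 + ε + ε / 6561) * t / 2 := by
            have h' : Real.log z ≤ (1 + ε + Core.eta ε) * t / 2 := hlogz2
            nlinarith only [h', mul_le_mul_of_nonneg_right hηε ht0.le]
          exact buchstab_main_real hε hε3' ht hK1 hKt hLΔ0 hlogΔz h1335 hdiff h201 hlogz2' hs3 hV0 hVΔb hVyb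
            hVy0.le hσb hσ0 hC₁5 hKerr herr0 hG0b hG'b hfs (by linarith only [hEC, hCe0])
      -- assemble
      have hSidΔ := hsplit (fun d => Core.LamZ hD hε 0 Δ d) (primesProdBelow Δ).divisors
      have hmsΔ : (msifted B Δ : ℝ) = ((B.filter fun b : ℤ => Int.gcd b (primesProdBelow Δ) = 1).card : ℝ) := rfl
      have hmsz : (msifted B z : ℝ) = ((B.filter fun b : ℤ => Int.gcd b (primesProdBelow z) = 1).card : ℝ) := rfl
      calc V * X * (lowerSieveFun 1 s - E) - R (alRow hD hε hD' (jst - 1) Mb cA' L₁) (blRow hD hε hD' Mb cA' L₁)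
          = X * (V * (lowerSieveFun 1 s - E)) +
              ∑ d ∈ (primesProdBelow Δ).divisors, Core.LamZ hD hε 0 Δ d * r d -
              ∑ p ∈ T, ∑ d ∈ (primesProdBelow D').divisors, Core.LamZ hD' hε 1 D' d * r (p * d) := by
            rw [hR]; ring
        _ ≤ X * (G0 - σ * G') + ∑ d ∈ (primesProdBelow Δ).divisors, Core.LamZ hD hε 0 Δ d * r d -
              ∑ p ∈ T, ∑ d ∈ (primesProdBelow D').divisors, Core.LamZ hD' hε 1 D' d * r (p * d) := by
            have := mul_le_mul_of_nonneg_left hkey hX.le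
            linarith
        _ = (X * G0 + ∑ d ∈ (primesProdBelow Δ).divisors, Core.LamZ hD hε 0 Δ d * r d) -
              (X * σ * G' + ∑ p ∈ T, ∑ d ∈ (primesProdBelow D').divisors, Core.LamZ hD' hε 1 D' d * r (p * d)) := by
            ring
        _ ≤ (msifted B Δ : ℝ) - ∑ p ∈ T,
              (((B.filter fun b : ℤ => (p : ℤ) ∣ b).filter fun b : ℤ => Int.gcd b (primesProdBelow D') = 1).card : ℝ) := by
            refine sub_le_sub ?_ hSsum
            rw [hG0def, ← hSidΔ, hmsΔ]; exact hSΔ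
        _ ≤ (msifted B z : ℝ) := by rw [hmsΔ, hmsz]; linarith


/-! ### The small branch (`log D₄ < 900 ε⁻²`): trivial families -/

set_option maxHeartbeats 400000 in
/-- The numerics of the small branch: `V⁻¹ ≤ 3.53 K log D`, `log D < 900 ε⁻²` give `V⁻¹, 1 ≤ E`. [folklore] -/
theorem small_numerics {ε t K Lc τ Vi c : ℝ} (hε : 0 < ε) (hε3 : ε ≤ 1 / 3) (ht0 : 0 < t) (ht9 : t < 900 * ε⁻¹ ^ 2)
    (hK1 : 1 ≤ K) (hLc : 0 ≤ Lc) (hτ1 : 1 ≤ τ) (hτ2 : τ ≤ 2) (hVi0 : 0 ≤ Vi) (hVi : Vi ≤ 3.53 * K * t)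
    (hc : 1e29 ≤ c) :
    Vi ≤ c * (ε + ε⁻¹ ^ 8 * Real.exp (K + Lc) * (τ * t) ^ (-(1 / 3 : ℝ))) ∧
      1 ≤ c * (ε + ε⁻¹ ^ 8 * Real.exp (K + Lc) * (τ * t) ^ (-(1 / 3 : ℝ))) := by
  have hεi : 3 ≤ ε⁻¹ := by rw [le_inv_comm₀ (by norm_num) hε]; linarith
  have he8 : 1 ≤ ε⁻¹ ^ 8 := one_le_pow₀ (by linarith)
  have he28 : ε⁻¹ ^ 2 ≤ ε⁻¹ ^ 8 := pow_le_pow_right₀ (by linarith) (by norm_num)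
  have hKe : K ≤ Real.exp K := by linarith [Real.add_one_le_exp K]
  have heKL : Real.exp K ≤ Real.exp (K + Lc) := Real.exp_le_exp.mpr (by linarith)
  have heK1 : 1 ≤ Real.exp K := by linarith
  have hτt0 : 0 < τ * t := by positivity
  set P := (τ * t) ^ (-(1 / 3 : ℝ)) with hP
  have hP0 : 0 < P := Real.rpow_pos_of_pos hτt0 _
  -- the key lower bound `ε⁻⁸ eᴷ P ≥ max(Vi, 1)/1e29`
  set Y := ε⁻¹ ^ 8 * Real.exp (K + Lc) * P with hY
  have hY0 : 0 ≤ Y := by positivity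
  have hbase : Vi ≤ 1e29 * Y ∧ 1 ≤ 1e29 * Y := by
    rcases le_or_gt (τ * t) 1 with hsmall | hbig
    · -- `P ≥ 1`
      have hP1 : 1 ≤ P := by
        rw [hP]; exact Real.one_le_rpow_of_pos_of_le_one_of_nonpos hτt0 hsmall (by norm_num)
      have hY1 : Real.exp K ≤ Y := by
        rw [hY]
        calc Real.exp K = 1 * Real.exp K * 1 := by ring
          _ ≤ ε⁻¹ ^ 8 * Real.exp (K + Lc) * P := by gcongr
      have ht1 : t ≤ 1 := by nlinarith
      constructor
      · nlinarith
      · nlinarith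
    · -- `P ≥ (τ t)⁻¹ ≥ 1/(2t)`
      have hP1 : (τ * t)⁻¹ ≤ P := by
        rw [hP, ← Real.rpow_neg_one]
        exact Real.rpow_le_rpow_of_exponent_le hbig.le (by norm_num)
      have hP2 : 1 / (2 * t) ≤ P := by
        refine le_trans ?_ hP1
        rw [one_div, inv_le_inv₀ (by positivity) hτt0]; nlinarith
      have hY1 : ε⁻¹ ^ 8 * Real.exp K * (1 / (2 * t)) ≤ Y := by rw [hY]; gcongr
      -- `Vi · 2t ≤ 7.06 K t² ≤ 7.06 · 8.1e5 ε⁻⁴ eᴷ ≤ 5.8e6 ε⁻⁸ eᴷ`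
      have ht2 : t ^ 2 ≤ 8.1e5 * ε⁻¹ ^ 4 := by nlinarith
      have he48 : ε⁻¹ ^ 4 ≤ ε⁻¹ ^ 8 := pow_le_pow_right₀ (by linarith) (by norm_num)
      have hX : ε⁻¹ ^ 8 * Real.exp K * (1 / (2 * t)) * (2 * t) = ε⁻¹ ^ 8 * Real.exp K := by field_simp
      have hY2 : ε⁻¹ ^ 8 * Real.exp K ≤ Y * (2 * t) := by
        have := mul_le_mul_of_nonneg_right hY1 (by positivity : 0 ≤ 2 * t); rwa [hX] at this
      constructor
      · -- `Vi ≤ 1e29 Y ⟸ Vi · 2t ≤ 1e29 Y · 2t` and `Vi · 2t ≤ 7.06 K t² ≤ 5.8e6 ε⁻⁸ eᴷ`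
        have h1 : Vi * (2 * t) ≤ 7.06 * Real.exp K * (8.1e5 * ε⁻¹ ^ 8) := by
          calc Vi * (2 * t) ≤ 3.53 * K * t * (2 * t) := mul_le_mul_of_nonneg_right hVi (by positivity)
            _ = 7.06 * K * t ^ 2 := by ring
            _ ≤ 7.06 * Real.exp K * (8.1e5 * ε⁻¹ ^ 8) := by
                refine mul_le_mul (by nlinarith) (ht2.trans (by nlinarith)) (by positivity) (by positivity)
        have h2 : Vi * (2 * t) ≤ 1e29 * Y * (2 * t) := by nlinarith
        exact le_of_mul_le_mul_right h2 (by positivity)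
      · have h1 : (1:ℝ) * (2 * t) ≤ 1800 * ε⁻¹ ^ 8 := by nlinarith
        have h2 : (1:ℝ) * (2 * t) ≤ 1e29 * Y * (2 * t) := by nlinarith
        exact le_of_mul_le_mul_right h2 (by positivity)
  have hc0 : 0 ≤ c := by linarith
  have hcε : 0 ≤ c * ε := mul_nonneg hc0 hε.le
  constructor
  · calc Vi ≤ 1e29 * Y := hbase.1
      _ ≤ c * Y := mul_le_mul_of_nonneg_right hc hY0
      _ ≤ c * (ε + Y) := by linarith
      _ = _ := by rw [hY]
  · calc (1:ℝ) ≤ 1e29 * Y := hbase.2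
      _ ≤ c * Y := mul_le_mul_of_nonneg_right hc hY0
      _ ≤ c * (ε + Y) := by linarith
      _ = _ := by rw [hY]

/-- **Theorem 1 in the small branch** (`log D₄ < 900 ε⁻²`, for `N ≤ M`): the trivial families
`a = b = δ₁` (upper) and `0` (lower) suffice, the error term being `≥ V(z)⁻¹` and `≥ 1`. [folklore] -/
theorem small_branch {Cd : ℝ} (hCd : 0 ≤ Cd)
    (hCdf : ∀ s : ℝ, 2 ≤ s → |lowerSieveFun 1 s - 1| ≤ Cd * Real.exp (-s))
    {ε M N : ℝ} (hε : 0 < ε) (hε3 : ε < 1 / 3) (hN : 1 < N) (hNM : N ≤ M)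
    (ht9 : Real.log (levD ε M N) < 900 * ε⁻¹ ^ 2) :
    ∃ (L : ℕ) (au bu al bl : ℕ → ℕ → ℝ),
      (L : ℝ) ≤ Real.exp (8 * ε⁻¹ ^ 3) ∧
      (∀ l m, |au l m| ≤ 1) ∧ (∀ l n, |bu l n| ≤ 1) ∧ (∀ l m, |al l m| ≤ 1) ∧ (∀ l n, |bl l n| ≤ 1) ∧
      ∀ (B : Multiset ℤ) (X : ℝ) (ω : ArithmeticFunction ℝ) (K Lc : ℝ),
        0 < X → ω.IsMultiplicative → (∀ n, 0 ≤ ω n) → (∀ p : ℕ, p.Prime → ω p < p) →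
        1 ≤ K → 1 ≤ Lc →
        (∀ w z : ℝ, 2 ≤ w → w < z →
          ∏ p ∈ (Nat.primesBelow ⌈z⌉₊).filter (fun p : ℕ => w ≤ (p : ℝ)), (1 - ω p / p)⁻¹ ≤
            Real.log z / Real.log w * (1 + K / Real.log w)) →
        ∀ z : ℝ, 2 ≤ z → z ≤ (M * N) ^ (1 / 2 : ℝ) →
          let s : ℝ := Real.log (M * N) / Real.log z
          let E : ℝ := 1e29 * (1 + Cd) ^ 2 * (ε + ε⁻¹ ^ 8 * Real.exp (K + Lc) * Real.log (M * N) ^ (-(1 / 3 : ℝ)))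
          let V : ℝ := ∏ p ∈ Nat.primesBelow ⌈z⌉₊, (1 - ω p / p)
          let r : ℕ → ℝ := fun d => (mcount B d : ℝ) - ω d / d * X
          let R : (ℕ → ℕ → ℝ) → (ℕ → ℕ → ℝ) → ℝ := fun a b =>
            ∑ l ∈ Finset.range L, ∑ m ∈ Finset.Ico 1 ⌈M⌉₊, ∑ n ∈ Finset.Ico 1 ⌈N⌉₊,
              if m * n ∣ primesProdBelow z then a l m * b l n * r (m * n) else 0
          (msifted B z : ℝ) ≤ V * X * (upperSieveFun 1 s + E) + R au bu ∧
            V * X * (lowerSieveFun 1 s - E) - R al bl ≤ (msifted B z : ℝ) := by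
  have hε3' : ε ≤ 1 / 3 := hε3.le
  obtain ⟨hD, hlogD⟩ := levD_basic hε hε3' hN hNM
  obtain ⟨-, -, hτ1, hτ2, -⟩ := tau_bounds hε hε3'
  have hτ0 : tauP ε ≠ 0 := by linarith only [hτ1]
  have hsqD := sqrt_le_levD hε hε3' hN hNM
  set D := levD ε M N with hDdef
  set t := Real.log D with htdef
  have ht0 : 0 < t := Real.log_pos hD
  have hMN1 : 1 < M * N := by nlinarith only [hN, hNM]
  have hLMN : Real.log (M * N) = tauP ε * t := by rw [hlogD]; field_simp
  set δ₁ : ℕ → ℕ → ℝ := fun _ m => if m = 1 then 1 else 0 with hδ₁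
  have hδ : ∀ l m, |δ₁ l m| ≤ 1 := fun l m => by rw [hδ₁]; dsimp only; split_ifs <;> simp
  refine ⟨1, δ₁, δ₁, fun _ _ => 0, fun _ _ => 0, by push_cast; exact Real.one_le_exp (by positivity),
    hδ, hδ, fun _ _ => by simp, fun _ _ => by simp, ?_⟩
  intro B X ω K Lc hX hω hω0 hωp hK1 hLc h1 z hz2 hzMN s E V r R
  set g := densityOf ω with hgdef
  have h01 : ∀ p : ℕ, p.Prime → 0 ≤ g p ∧ g p < 1 := densityOf_prime_bounds hω0 hωp
  have h1g : ∀ w z : ℝ, 2 ≤ w → w < z →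
      ∏ p ∈ (Nat.primesBelow ⌈z⌉₊).filter (fun p : ℕ => w ≤ (p : ℝ)), (1 - g p)⁻¹ ≤
        Real.log z / Real.log w * (1 + K / Real.log w) := h1
  have hVeq : BetaSieve.vprod g (primesProdBelow z) = V := vprod_densityOf_eq ω z
  have hV0 : 0 < V := hVeq ▸ vprod_pos_of_lt_one fun p hp => (h01 p (Nat.prime_of_mem_primeFactors hp)).2
  have hzD : z ≤ D := hzMN.trans hsqD
  have hz0 : 0 < z := by linarith
  have hlogz0 : 0 < Real.log z := Real.log_pos (by linarith)
  have hs2 : 2 ≤ s := by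
    show 2 ≤ Real.log (M * N) / Real.log z
    rw [le_div_iff₀ hlogz0]
    have := Real.log_le_log hz0 hzMN
    rw [Real.log_rpow (by linarith)] at this; linarith
  -- `V⁻¹ ≤ E` and `1 ≤ E`
  have hVi := Core.inv_vprod_le_crude hD hK1 h1g hz2 hzD
  rw [hVeq] at hVi
  obtain ⟨hEV, hE1⟩ := small_numerics hε hε3' ht0 ht9 hK1 (by linarith : 0 ≤ Lc) hτ1.le hτ2
    (inv_nonneg.mpr hV0.le) hVi (c := 1e29 * (1 + Cd) ^ 2) (by nlinarith)
  rw [← hLMN] at hEV hE1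
  change V⁻¹ ≤ E at hEV
  change 1 ≤ E at hE1
  have hVE : 1 ≤ V * E := by
    have := mul_le_mul_of_nonneg_left hEV hV0.le
    rwa [mul_inv_cancel₀ hV0.ne'] at this
  constructor
  · -- upper: `R δ₁ δ₁ = |ℬ| − X`
    have h1M : 1 ∈ Finset.Ico 1 ⌈M⌉₊ := by
      rw [Finset.mem_Ico]; exact ⟨le_rfl, Nat.lt_ceil.mpr (by push_cast; linarith)⟩
    have h1N : 1 ∈ Finset.Ico 1 ⌈N⌉₊ := by
      rw [Finset.mem_Ico]; exact ⟨le_rfl, Nat.lt_ceil.mpr (by exact_mod_cast hN)⟩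
    have hR : R δ₁ δ₁ = (Multiset.card B : ℝ) - X := by
      show ∑ l ∈ Finset.range 1, ∑ m ∈ Finset.Ico 1 ⌈M⌉₊, ∑ n ∈ Finset.Ico 1 ⌈N⌉₊,
        (if m * n ∣ primesProdBelow z then δ₁ l m * δ₁ l n * r (m * n) else 0) = _
      rw [Finset.sum_range_one, Finset.sum_eq_single_of_mem 1 h1M, Finset.sum_eq_single_of_mem 1 h1N]
      · simp only [hδ₁, mul_one, one_dvd, if_true, one_mul]
        show ((mcount B 1 : ℝ) - ω 1 / ((1:ℕ):ℝ) * X) = _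
        have hm1 : mcount B 1 = Multiset.card B := by
          unfold mcount; congr 1; exact Multiset.filter_eq_self.mpr fun b _ => by simp
        rw [hm1, hω.map_one]; simp
      · intro n _ hn1; simp [hδ₁, hn1]
      · intro m _ hm1
        refine Finset.sum_eq_zero fun n _ => ?_
        simp [hδ₁, hm1]
    have hms : (msifted B z : ℝ) ≤ Multiset.card B := by
      rw [msifted]; exact_mod_cast Multiset.card_le_card (Multiset.filter_le _ B)
    have hF0 : 0 ≤ upperSieveFun 1 s := by
      have := BetaSieve.Iwaniec1980_lemma18_holds.one_le_upper (by norm_num : (1:ℝ) / 2 ≤ 1)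
        JurkatRichert.isGreatestBetaSieveData_linear (s := s) (by linarith)
      simp only at this; linarith
    rw [hR]
    nlinarith [mul_nonneg hV0.le hF0, hX]
  · -- lower: `R 0 0 = 0`, `f₁ ≤ 1 ≤ E`
    have hR : R (fun _ _ => 0) (fun _ _ => 0) = 0 := by
      show ∑ l ∈ Finset.range 1, ∑ m ∈ Finset.Ico 1 ⌈M⌉₊, ∑ n ∈ Finset.Ico 1 ⌈N⌉₊,
        (if m * n ∣ primesProdBelow z then (0:ℝ) * 0 * r (m * n) else 0) = 0
      exact Finset.sum_eq_zero fun _ _ => Finset.sum_eq_zero fun _ _ => Finset.sum_eq_zero fun _ _ => by simp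
    have hf1 : lowerSieveFun 1 s ≤ 1 := (lowerSieveFun_bounds hCd hCdf hs2).1
    have hms : (0:ℝ) ≤ msifted B z := Nat.cast_nonneg _
    rw [hR, sub_zero]
    nlinarith [mul_pos hV0 hX]

/-! ### Theorem 1 for `N ≤ M`, and by symmetry in general -/

/-- **Iwaniec's Theorem 1 / Lemma 2 for `N ≤ M`** with the tree's `F₁, f₁`. [cite: IwaniecActaArith1980b, Theorem 1] -/
theorem lemma2_core : ∃ c₀ : ℝ, 0 < c₀ ∧
    ∀ (ε M N : ℝ), 0 < ε → ε < 1 / 3 → 1 < N → N ≤ M →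
      ∃ (L : ℕ) (au bu al bl : ℕ → ℕ → ℝ),
        (L : ℝ) ≤ Real.exp (8 * ε⁻¹ ^ 3) ∧
        (∀ l m, |au l m| ≤ 1) ∧ (∀ l n, |bu l n| ≤ 1) ∧ (∀ l m, |al l m| ≤ 1) ∧ (∀ l n, |bl l n| ≤ 1) ∧
        ∀ (B : Multiset ℤ) (X : ℝ) (ω : ArithmeticFunction ℝ) (K Lc : ℝ),
          0 < X → ω.IsMultiplicative → (∀ n, 0 ≤ ω n) → (∀ p : ℕ, p.Prime → ω p < p) →
          1 ≤ K → 1 ≤ Lc →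
          (∀ w z : ℝ, 2 ≤ w → w < z →
            ∏ p ∈ (Nat.primesBelow ⌈z⌉₊).filter (fun p : ℕ => w ≤ (p : ℝ)), (1 - ω p / p)⁻¹ ≤
              Real.log z / Real.log w * (1 + K / Real.log w)) →
          ∀ z : ℝ, 2 ≤ z → z ≤ (M * N) ^ (1 / 2 : ℝ) →
            let s : ℝ := Real.log (M * N) / Real.log z
            let E : ℝ := c₀ * (ε + ε⁻¹ ^ 8 * Real.exp (K + Lc) * Real.log (M * N) ^ (-(1 / 3 : ℝ)))
            let V : ℝ := ∏ p ∈ Nat.primesBelow ⌈z⌉₊, (1 - ω p / p)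
            let r : ℕ → ℝ := fun d => (mcount B d : ℝ) - ω d / d * X
            let R : (ℕ → ℕ → ℝ) → (ℕ → ℕ → ℝ) → ℝ := fun a b =>
              ∑ l ∈ Finset.range L, ∑ m ∈ Finset.Ico 1 ⌈M⌉₊, ∑ n ∈ Finset.Ico 1 ⌈N⌉₊,
                if m * n ∣ primesProdBelow z then a l m * b l n * r (m * n) else 0
            (msifted B z : ℝ) ≤ V * X * (upperSieveFun 1 s + E) + R au bu ∧
              V * X * (lowerSieveFun 1 s - E) - R al bl ≤ (msifted B z : ℝ) := by
  obtain ⟨Cd, hCd, hCdF, hCdf⟩ := exists_linearSieve_decay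
  refine ⟨1e29 * (1 + Cd) ^ 2, by positivity, ?_⟩
  intro ε M N hε hε3 hN hNM
  by_cases ht9 : 900 * ε⁻¹ ^ 2 ≤ Real.log (levD ε M N)
  · exact real_branch hCd hCdF hCdf hε hε3 hN hNM ht9
  · exact small_branch hCd hCdf hε hε3 hN hNM (not_le.mp ht9)

/-- **DISCHARGE of `lemma2_bilinearSieve`** — H. Iwaniec's Theorem 1 of *A new form of the error term in
the linear sieve* (= Lemma 2 of the Inventiones paper): the general case follows from `lemma2_core` by the
symmetry `(M, a) ↔ (N, b)` of the remainder term and the identification of `IsLinearSieveFunctions F f`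
with `(F₁, f₁)`. [cite: IwaniecActaArith1980b, Theorem 1] -/
theorem lemma2_bilinearSieve_holds : lemma2_bilinearSieve := by
  obtain ⟨c₀, hc₀, hcore⟩ := lemma2_core
  refine ⟨c₀, hc₀, ?_⟩
  intro F f hFf ε M N hε hε3 hM hN
  rcases le_total N M with hNM | hMN
  · obtain ⟨L, au, bu, al, bl, hL, hau, hbu, hal, hbl, htail⟩ := hcore ε M N hε hε3 hN hNM
    refine ⟨L, au, bu, al, bl, hL, hau, hbu, hal, hbl, ?_⟩
    intro B X ω K Lc hX hω hω0 hωp hK hLc h1 _h2 z hz hzMN s E V r R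
    have h := htail B X ω K Lc hX hω hω0 hωp hK hLc h1 z hz hzMN
    have hs0 : 0 < s := by
      show 0 < Real.log (M * N) / Real.log z
      exact div_pos (Real.log_pos (by nlinarith)) (Real.log_pos (by linarith))
    obtain ⟨hF, hf⟩ := hFf.eq_std hs0
    rw [hF, hf]
    exact h
  · obtain ⟨L, au', bu', al', bl', hL, hau, hbu, hal, hbl, htail⟩ := hcore ε N M hε hε3 hM hMN
    refine ⟨L, bu', au', bl', al', hL, hbu, hau, hbl, hal, ?_⟩
    intro B X ω K Lc hX hω hω0 hωp hK hLc h1 _h2 z hz hzMN s E V r R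
    have hzNM : z ≤ (N * M) ^ (1 / 2 : ℝ) := by rwa [mul_comm N M]
    have h := htail B X ω K Lc hX hω hω0 hωp hK hLc h1 z hz hzNM
    have hs0 : 0 < s := by
      show 0 < Real.log (M * N) / Real.log z
      exact div_pos (Real.log_pos (by nlinarith)) (Real.log_pos (by linarith))
    obtain ⟨hF, hf⟩ := hFf.eq_std hs0
    rw [hF, hf]
    -- the symmetry of the remainder term
    have hR : ∀ a b : ℕ → ℕ → ℝ, R b a =
        ∑ l ∈ Finset.range L, ∑ m ∈ Finset.Ico 1 ⌈N⌉₊, ∑ n ∈ Finset.Ico 1 ⌈M⌉₊,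
          (if m * n ∣ primesProdBelow z then a l m * b l n * r (m * n) else 0) := by
      intro a b
      show ∑ l ∈ Finset.range L, ∑ m ∈ Finset.Ico 1 ⌈M⌉₊, ∑ n ∈ Finset.Ico 1 ⌈N⌉₊,
          (if m * n ∣ primesProdBelow z then b l m * a l n * r (m * n) else 0) = _
      refine Finset.sum_congr rfl fun l _ => ?_
      rw [Finset.sum_comm]
      refine Finset.sum_congr rfl fun x _ => Finset.sum_congr rfl fun y _ => ?_
      rw [mul_comm y x]
      split_ifs
      · ring
      · rfl
    rw [hR au' bu', hR al' bl']
    rw [mul_comm N M] at h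
    exact h

end Iwaniec1978

end Literature.NumberTheory.Sieve

end
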